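import Mathlib.NumberTheory.SelbergSieve
import Mathlib.NumberTheory.Harmonic.EulerMascheroni
import Mathlib.Analysis.SpecialFunctions.Pow.Real
import Mathlib.Analysis.Calculus.Deriv.Basic
import Mathlib.Analysis.Asymptotics.Defs
import Literature.NumberTheory.Sieve.LevelOfDistribution
import Literature.NumberTheory.Sieve.SieveFramework
import HarnessLib

-- D-0014 sorry-sweep (operator, 2026-08-13): sorried theorems -> named facts `def X : Prop`; partial proofs preserved in comments
-- provenance: harness21/H21/H21/Prelude/AntSieve/SieveFunctions.lean @ 7fbbdec (interim HEAD d8f2665); M5 mechanical rewrite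
/-!
# Sieve framework, part 2: the `β`-sieve functions `F_κ, f_κ` and the Jurkat–Richert / Iwaniec bounds

Trunk `AntSieve`, item C14 (`sieve_framework`, part 2).

For a sieve dimension `κ` the Rosser–Iwaniec `β`-sieve produces two continuous functions
`F = F_κ ≥ f = f_κ` on `(0, ∞)`, the sifting limit `β = β_κ ≥ 1` and a constant `A = A_κ > 0`
solving the delay-differential system (Iwaniec, *Rosser's sieve*, Acta Arith. 36 (1980), (1.7)–(1.10);
Friedlander–Iwaniec, *Opera de Cribro*, Ch. 11, (11.41)–(11.44); Halberstam–Richert Ch. 8, (2.7)–(2.10)):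

* `s^κ F(s) = A` for `0 < s ≤ β + 1`, `f(s) = 0` for `0 < s ≤ β`;
* `(s^κ F(s))' = κ s^{κ−1} f(s − 1)` for `s > β + 1`, `(s^κ f(s))' = κ s^{κ−1} F(s − 1)` for `s > β`;
* `F(s) = 1 + O(e^{−s})`, `f(s) = 1 + O(e^{−s})`.

For `κ = 1` (Jurkat–Richert, Acta Arith. 11 (1965); Halberstam–Richert Thm 8.3–8.4): `β₁ = 2`,
`A₁ = 2e^γ`, `F(s) = 2e^γ/s` on `(0, 3]`, `f(s) = 2e^γ log(s − 1)/s` on `[2, 4]`.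

Mathlib has none of this (searched: no sieve functions, delay-differential equations, Dickman/Buchstab
functions); we use `Real.eulerMascheroniConstant`, `HasDerivAt`, `Real.rpow`, `Asymptotics.IsBigO` and
the H21 sequence layer (`SieveSequence`, `HasLevelOfDistribution`, `HasSieveDimension`,
`primesProdBelow`, `SieveSequence.sifted`, `SieveSequence.densityProduct`).

## Contents

* `IsBetaSieveSolution κ F f β A` — the system above (a `Prop`-valued structure);
  `IsBetaSieveData κ (F, f, β, A)` — a solution whose `β` is least among all solutions;
  `BetaSieveFunctions κ` — the bundled form (a hypothesis structure) with the bridge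
  `BetaSieveFunctions.ofIsBetaSieveData`.
* `exists_isBetaSieveData` (Iwaniec 1980; named fact, DISCHARGED as `exists_isBetaSieveData_holds`
  in `SieveFunctionsProofs.lean`), `IsBetaSieveData.unique` (named fact, DISCHARGED as
  `IsBetaSieveData.unique_holds` below).
* `betaSieveData κ` (`Classical.epsilon`), `upperSieveFun κ = F_κ`, `lowerSieveFun κ = f_κ`,
  `siftingLimit κ = β_κ`; the linear-sieve values `siftingLimit_one`, `upperSieveFun_one_eq`,
  `lowerSieveFun_one_eq` (named facts, DISCHARGED as `siftingLimit_one_holds` in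
  `LinearSieveExistence.lean` and as `upperSieveFun_one_eq_holds`, `lowerSieveFun_one_eq_holds` in
  `LinearSieveConstant.lean`).
* `HasIwaniecDimension g κ L` — Iwaniec's regular dimension condition `Ω(κ, L)`.
* RETIRED (2026-08-15, see the section "The least-`β` transcriptions of the sieve bounds: REFUTED and
  RETIRED" below): the former named facts `SieveSequence.jurkat_richert_upper` /
  `SieveSequence.jurkat_richert_lower` (D-0014 sorry-sweep transcriptions of Iwaniec's Theorem 1 with
  the least-`β` functions `upperSieveFun κ`, `lowerSieveFun κ` for every `κ ≥ 1/2`) are FALSE — the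
  least-`β` pin is not Iwaniec's definition of `β_κ`: for `1/2 ≤ κ ≤ 1` the two pins coincide and
  the statements restricted to such `κ` are PROVED (`SieveSequence.jurkat_richert_upper_of_le_one`,
  `…_lower_of_le_one` in `BetaSieveSmallDimension.lean`, unconditionally `…_of_le_one_holds` in
  `JurkatRichertHalfLt.lean`); for EVERY `κ > 1` the least-`β` pin provably selects other
  functions (`siftingLimit_lt_iwaniecSiftingLimit`, `upperSieveFun_ne_iwaniecUpperSieveFun`,
  `lowerSieveFun_ne_iwaniecLowerSieveFun` in `BetaSieveLargeDimension.lean`; for `κ = 3/2` explicitly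
  `SieveFunctionsProofs.siftingLimit_three_halves_lt`); and for `κ = 2` BOTH statements are REFUTED
  (`SieveSequence.not_jurkat_richert_upper`, `SieveSequence.not_jurkat_richert_lower` in
  `JurkatRichertRefutation.lean`, which state the negated propositions verbatim). The two `def`s
  were therefore deleted from this file (a refuted statement is not a named fact); the faithful
  statements are `SieveSequence.Iwaniec1980_upper` / `Iwaniec1980_lower` below.
* ERRATUM section (2026-08-14): `IsBetaSieveSolution.unique_of_beta_eq` (uniqueness for the
  delay-differential initial value problem, proved; discharges `IsBetaSieveData.unique` as
  `IsBetaSieveData.unique_holds`); `IsGreatestBetaSieveData κ (F, f, β, A)` — the CORRECT pin of Iwaniec's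
  data (greatest admissible `β`), `greatestBetaSieveData`, `iwaniecUpperSieveFun`, `iwaniecLowerSieveFun`,
  `iwaniecSiftingLimit`, `iwaniecSieveConst`, `exists_isGreatestBetaSieveData` (named fact,
  DISCHARGED as `exists_isGreatestBetaSieveData_holds` in `SieveFunctionsProofs.lean`),
  `IsGreatestBetaSieveData.unique` (proved); Iwaniec's Theorem 1 in its printed `y`-form
  `Iwaniec1980_thm1_lower`, `Iwaniec1980_thm1_upper` (named facts); the corrected corollaries
  `SieveSequence.Iwaniec1980_lower` / `Iwaniec1980_upper` (named facts) together with the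
  PROVED reductions `SieveSequence.Iwaniec1980_lower_of_thm1 : Iwaniec1980_thm1_lower → …` and
  `SieveSequence.Iwaniec1980_upper_of_thm1`.

## Design notes (deviations from the outline, all documented at the declarations)

* Normalisation. The outline's `Tendsto F atTop (𝓝 1)`, `Tendsto f atTop (𝓝 1)` does NOT determine
  `β`: for every `β ≥ 1` the system has solutions with `F, f → 1`, the difference `F − f` decaying like
  `c s^{−2κ}`. The literature's normalisation is `F, f = 1 + O(e^{−s})` (Friedlander–Iwaniec (11.31),
  Iwaniec 1980 (1.10)), which we use (`IsBigO` against `exp (−s)`); it implies the `Tendsto` form.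
* Sifting limit. `β_κ` is the sifting limit, i.e. the least admissible `β`; we make minimality part of
  `IsBetaSieveData`, so that `IsBetaSieveData.unique` reduces to uniqueness for delay-differential
  equations plus the normalisation, and `siftingLimit κ` means what the literature means.
  **ERRATUM (2026-08-14): this premise is not what the sources print, and it FAILS for every
  `κ > 1` (`BetaSieveLargeDimension.siftingLimit_lt_iwaniecSiftingLimit`; worked out explicitly for
  `κ = 3/2` and `κ = 2`, see below).** Iwaniec DEFINES `β_κ − 1` as the LARGEST zero of the adjoint function `g_κ`
  (Iwaniec 1980, §6, p. 189 and §7, p. 193), and `g_κ` can have several positive zeros when `κ > 1`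
  (two for `κ = 3/2`, where `g(s) = s² − 3s + 3/2`, three for `κ = 2`, where
  `g(s) = s³ − 6s² + 9s − 8/3`: polynomials printed ibid. §5.1, Example 2; always fewer than `2κ`
  zeros, ibid. §5.2, Corollary to Lemma 4). Every normalised solution has `g_κ(β − 1) = 0` or `β = 1`
  (pairing identity, see the section "Correction (2026-08-14)" below), and the normalised system is
  solvable at EVERY positive zero of `g_κ` (`BetaSieveForward.exists_isBetaSieveSolution_of_qFun_eq_zero`
  in `SieveFunctionsProofs.lean`; Greaves, *Sieves in Number Theory*, Lemmas 4.2.5–4.2.6), so that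
  whenever `g_κ` has two positive zeros — which is the case for EVERY `κ > 1`
  (`SieveAdjoint.exists_two_zeros_qFun` in `BetaSieveLargeDimension.lean`, by Greaves's induction
  step for Lemma 4.2.3 (ii); not printed in the sources) — the LEAST admissible `β` is not `β_κ` and
  `lowerSieveFun κ`, `upperSieveFun κ`, `siftingLimit κ` (and the sieve bounds stated with them,
  the former `SieveSequence.jurkat_richert_lower/upper`, retired 2026-08-15) do not denote / assert
  what the cited sources do for such `κ`: for `κ = 3/2`,
  `siftingLimit (3/2) = (5 − √3)/2 < β_{3/2} = (5 + √3)/2`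
  (`SieveFunctionsProofs.siftingLimit_three_halves_lt`); for `κ = 2`, `1.39 < siftingLimit 2 < 1.393`
  (whereas `β_2 − 1` is the largest zero, `≈ 3.834`, of `g_2`) and both sieve statements are FALSE
  (`JurkatRichertRefutation.lean`). In any case the least-`β` pin is an identification no source
  makes, so these declarations are marked as errata. The Correction section re-pins the data by the
  GREATEST admissible `β` (`IsGreatestBetaSieveData`) under new names; the old least-`β` data
  declarations are kept unchanged, the two refuted sieve-bound facts are deleted (retirement section
  below). (For `1/2 ≤ κ ≤ 1` the two pins AGREE: for `κ = 1/2`, `g_{1/2} = 1` has no zero, so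
  `β = 1` is forced; for `κ = 1`, `g_1(s) = s − 1`, and `β = 1` is inadmissible because
  `(s f(s))' = A/(s − 1)` is not integrable at `s = 1`; for `1/2 < κ < 1`, `g_κ` has exactly one
  positive zero (ibid. Lemma 5) and `β = 1` is again inadmissible, the pairing constant at `β = 1`
  being the nonzero coefficient of the singular part `s^{κ−1}` of `g_κ` at `0`. All of this is
  PROVED: `SieveFunctionsBridge.lean` (`κ ∈ {1/2, 1}`), `LinearSieveExistence.lean` (`β_1 = 2`),
  `BetaSieveSmallDimension.lean` (`IsBetaSieveSolution.one_lt_of_half_lt`,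
  `isBetaSieveData_eq_isGreatestBetaSieveData` for `1/2 ≤ κ ≤ 1`).)
* Range of `κ`. We require `1 ≤ β` (not `1 < β`): `β_{1/2} = 1`. For `0 < κ < 1/2` Iwaniec's system
  is degenerate (`β = 1` and `s^κ f(s) = B > 0` on `(0, 1]`, Iwaniec 1980 Thm 1), which is not of the
  above shape; hence `exists_isBetaSieveData` assumes `1/2 ≤ κ`.
* Dimension hypothesis of the main theorems. The asymptotic bounds `S ≤ X V(z) (F(s) + ε)`,
  `S ≥ X V(z) (f(s) − ε)` require Iwaniec's regular condition
  `∏_{w ≤ p < z} (1 − g(p))⁻¹ ≤ (log z / log w)^κ (1 + L / log w)` (Iwaniec 1980 (1.2) `Ω(κ, L)`;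
  Friedlander–Iwaniec (11.129); Halberstam–Richert `Ω₂(κ, L)`), not merely `HasSieveDimension g κ K`
  with a fixed constant `K` (which allows a fixed-factor loss). We introduce `HasIwaniecDimension` and
  prove `HasIwaniecDimension.hasSieveDimension`.
* In `SieveSequence.Iwaniec1980_upper/lower` (as in the retired least-`β` transcriptions
  `jurkat_richert_upper/lower`) the sifting range is `2 ≤ z ≤ x^{θ − δ}` for an arbitrary fixed
  `δ > 0` (the level of distribution is `x^{θ − ε'}` for every `ε' > 0`, and Iwaniec's theorem needs
  `z ≤ D`); the argument of `F_κ, f_κ` is nevertheless `θ log x / log z` (continuity of `F_κ, f_κ`).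
  The hypothesis `A.IsSiftable (P z)` of the outline is NOT assumed (Friedlander–Iwaniec Ch. 11 only use
  `0 ≤ g(p) < 1`, part of the dimension condition; `IsSiftable` fails for the shifted primes), exactly as
  in `SieveSequence.fundamental_lemma`; the hypothesis `0 ≤ X(x)` eventually is added.
-/

open Filter Asymptotics Finset

noncomputable section

namespace Literature.NumberTheory.Sieve

/-! ### The delay-differential system of the `β`-sieve -/

/-- `IsBetaSieveSolution κ F f β A`: the quadruple `(F, f, β, A)` solves the Rosser–Iwaniec
`β`-sieve delay-differential system of dimension `κ` with parameter `β ≥ 1` and constant `A > 0`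
(Iwaniec, Acta Arith. 36 (1980), (1.7)–(1.10); Friedlander–Iwaniec, *Opera de Cribro*, (11.41)–(11.44)
and (11.31); Halberstam–Richert Ch. 8, (2.7)–(2.10)):
`F(s) = A s^{−κ}` on `(0, β + 1]`, `f(s) = 0` on `(0, β]`, `(s^κ F(s))' = κ s^{κ−1} f(s − 1)` for
`s > β + 1`, `(s^κ f(s))' = κ s^{κ−1} F(s − 1)` for `s > β`, `F, f` continuous on `(0, ∞)`, and the
normalisation `F(s) = 1 + O(e^{−s})`, `f(s) = 1 + O(e^{−s})` as `s → ∞`. [folklore] -/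
structure IsBetaSieveSolution (κ : ℝ) (F f : ℝ → ℝ) (β A : ℝ) : Prop where
  /-- `1 ≤ β`. -/
  one_le : 1 ≤ β
  /-- `0 < A`. -/
  pos : 0 < A
  /-- Initial condition `F(s) = A s^{−κ}` for `0 < s ≤ β + 1`. -/
  upper_eq : ∀ s ∈ Set.Ioc 0 (β + 1), F s = A * s ^ (-κ)
  /-- Initial condition `f(s) = 0` for `0 < s ≤ β`. -/
  lower_eq : ∀ s ∈ Set.Ioc 0 β, f s = 0
  /-- `(s^κ F(s))' = κ s^{κ−1} f(s − 1)` for `s > β + 1`. -/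
  hasDerivAt_upper : ∀ s : ℝ, β + 1 < s →
    HasDerivAt (fun t : ℝ => t ^ κ * F t) (κ * s ^ (κ - 1) * f (s - 1)) s
  /-- `(s^κ f(s))' = κ s^{κ−1} F(s − 1)` for `s > β`. -/
  hasDerivAt_lower : ∀ s : ℝ, β < s →
    HasDerivAt (fun t : ℝ => t ^ κ * f t) (κ * s ^ (κ - 1) * F (s - 1)) s
  /-- `F` is continuous on `(0, ∞)`. -/
  continuousOn_upper : ContinuousOn F (Set.Ioi 0)
  /-- `f` is continuous on `(0, ∞)`. -/
  continuousOn_lower : ContinuousOn f (Set.Ioi 0)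
  /-- Normalisation `F(s) = 1 + O(e^{−s})`. -/
  upper_isBigO : (fun s : ℝ => F s - 1) =O[atTop] fun s : ℝ => Real.exp (-s)
  /-- Normalisation `f(s) = 1 + O(e^{−s})`. -/
  lower_isBigO : (fun s : ℝ => f s - 1) =O[atTop] fun s : ℝ => Real.exp (-s)

namespace IsBetaSieveSolution

variable {κ : ℝ} {F f : ℝ → ℝ} {β A : ℝ}

/-- The normalisation implies `F(s) → 1` (the outline's form of the boundary condition). [folklore] -/
theorem tendsto_upper (h : IsBetaSieveSolution κ F f β A) : Tendsto F atTop (nhds 1) := by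
  have h0 : Tendsto (fun s : ℝ => F s - 1) atTop (nhds 0) :=
    h.upper_isBigO.trans_tendsto (Real.tendsto_exp_comp_nhds_zero.mpr tendsto_neg_atTop_atBot)
  simpa using h0.add_const 1

/-- The normalisation implies `f(s) → 1` (the outline's form of the boundary condition). [folklore] -/
theorem tendsto_lower (h : IsBetaSieveSolution κ F f β A) : Tendsto f atTop (nhds 1) := by
  have h0 : Tendsto (fun s : ℝ => f s - 1) atTop (nhds 0) :=
    h.lower_isBigO.trans_tendsto (Real.tendsto_exp_comp_nhds_zero.mpr tendsto_neg_atTop_atBot)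
  simpa using h0.add_const 1

end IsBetaSieveSolution

/-- `IsBetaSieveData κ (F, f, β, A)`: `(F, f, β, A)` are THE `β`-sieve data of dimension `κ`, i.e.
`(F, f, β, A)` solves the normalised Rosser–Iwaniec system (`IsBetaSieveSolution`) and `β` is the least
parameter for which a normalised solution exists — `β = β_κ` is the sifting limit
(Friedlander–Iwaniec, *Opera de Cribro*, §11.4 and Table 11.1; Iwaniec 1980 §1). Stated on the product
type so that `Classical.epsilon` applies (`betaSieveData`). ERRATUM (2026-08-14): Iwaniec's `β_κ` is
`1 +` the LARGEST zero of `g_κ` (ibid. §7, p. 193); this is the least admissible `β` for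
`1/2 ≤ κ ≤ 1` (`BetaSieveSmallDimension.isBetaSieveData_eq_isGreatestBetaSieveData`) but for no
`κ > 1` (`BetaSieveLargeDimension.siftingLimit_lt_iwaniecSiftingLimit`; explicitly for `κ = 3/2`,
`SieveFunctionsProofs.siftingLimit_three_halves_lt`, and for `κ = 2`, `JurkatRichertRefutation.lean`);
the faithful pin is `IsGreatestBetaSieveData` (greatest `β`), see
the Correction section below. [cite: IwaniecActaArith1980, §1] -/
def IsBetaSieveData (κ : ℝ) (B : (ℝ → ℝ) × (ℝ → ℝ) × ℝ × ℝ) : Prop :=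
  IsBetaSieveSolution κ B.1 B.2.1 B.2.2.1 B.2.2.2 ∧
    ∀ (F' f' : ℝ → ℝ) (β' A' : ℝ), IsBetaSieveSolution κ F' f' β' A' → B.2.2.1 ≤ β'

/-- Unfolding lemma for `IsBetaSieveData` on an explicit quadruple. [folklore] -/
theorem isBetaSieveData_iff (κ : ℝ) (F f : ℝ → ℝ) (β A : ℝ) :
    IsBetaSieveData κ (F, f, β, A) ↔ IsBetaSieveSolution κ F f β A ∧
      ∀ (F' f' : ℝ → ℝ) (β' A' : ℝ), IsBetaSieveSolution κ F' f' β' A' → β ≤ β' :=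
  Iff.rfl

/-- **Existence of the `β`-sieve functions** (Iwaniec, *Rosser's sieve*, Acta Arith. 36 (1980), Thm 1
and §§3–4; Friedlander–Iwaniec, *Opera de Cribro*, Thm 11.9 and §11.4; for `κ = 1` Jurkat–Richert
1965 / Halberstam–Richert Thm 8.3): for every dimension `κ ≥ 1/2` there are `F_κ, f_κ, β_κ ≥ 1, A_κ > 0`
solving the normalised system, with `β_κ` least. (For `0 < κ < 1/2` Iwaniec's system is degenerate,
`s^κ f(s) = B > 0` on `(0, 1]`, and is not covered by `IsBetaSieveSolution`.) ERRATUM (2026-08-14):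
what Iwaniec proves is existence with `β_κ − 1` the LARGEST zero of `g_κ` (ibid. §7, p. 193), vendored
as `exists_isGreatestBetaSieveData` below. Since every admissible `β` lies in the finite set
`{1} ∪ (1 + g_κ⁻¹(0))` (pairing identity (5.3), cf. (7.12), see the Correction section; `g_κ` has
fewer than `2κ` zeros, ibid. §5.2, Corollary to Lemma 4), a least admissible `β` exists as soon as
some admissible `β` does (DISCHARGED along these lines: `exists_isBetaSieveData_holds` in
`SieveFunctionsProofs.lean`); it is `β_κ` for `1/2 ≤ κ ≤ 1` (`BetaSieveSmallDimension.lean`), but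
it is `< β_κ` for every `κ > 1` (`BetaSieveLargeDimension.siftingLimit_lt_iwaniecSiftingLimit`),
e.g. for `κ = 3/2` it is `(5 − √3)/2 < β_{3/2} = (5 + √3)/2`
(`SieveFunctionsProofs.siftingLimit_three_halves_lt`), its solution then not being Iwaniec's `(F, f)`
(see the Correction section).
[cite: IwaniecActaArith1980, Thm 1 and §7 (prints the greatest-β form; for the least-β form see the erratum)] -/
def exists_isBetaSieveData : Prop :=
  ∀ {κ : ℝ} (_hκ : 1 / 2 ≤ κ),
    ∃ B : (ℝ → ℝ) × (ℝ → ℝ) × ℝ × ℝ, IsBetaSieveData κ B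

/-- **Uniqueness of the `β`-sieve data**: two `β`-sieve data of the same dimension have the same
`β` (minimality), hence the same `F, f` on `(0, ∞)` (uniqueness for the delay-differential system with
the given initial conditions, up to the scalar `A`) and the same `A` (normalisation `F → 1`)
(Friedlander–Iwaniec, *Opera de Cribro*, §11.3–11.4). Only the values on `(0, ∞)` are determined.
DISCHARGED: `IsBetaSieveData.unique_holds` below. [cite: FriedlanderIwaniecOpera2010, §11.3–11.4] -/
def IsBetaSieveData.unique : Prop :=
  ∀ {κ : ℝ} {B B' : (ℝ → ℝ) × (ℝ → ℝ) × ℝ × ℝ} (_h : IsBetaSieveData κ B)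
    (_h' : IsBetaSieveData κ B'),
    Set.EqOn B.1 B'.1 (Set.Ioi 0) ∧ Set.EqOn B.2.1 B'.2.1 (Set.Ioi 0) ∧
      B.2.2.1 = B'.2.2.1 ∧ B.2.2.2 = B'.2.2.2

/-! ### Bundled form -/

/-- `BetaSieveFunctions κ`: the `β`-sieve data of dimension `κ` in bundled form (a hypothesis
structure): functions `F, f`, sifting limit `β` and constant `A` with `IsBetaSieveData κ (F, f, β, A)`
(Friedlander–Iwaniec, *Opera de Cribro*, Ch. 11). [folklore] -/
structure BetaSieveFunctions (κ : ℝ) where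
  /-- The upper-bound sieve function `F_κ`. -/
  F : ℝ → ℝ
  /-- The lower-bound sieve function `f_κ`. -/
  f : ℝ → ℝ
  /-- The sifting limit `β_κ`. -/
  β : ℝ
  /-- The constant `A_κ` with `F(s) = A s^{−κ}` on `(0, β + 1]`. -/
  A : ℝ
  /-- The data solve the normalised `β`-sieve system with `β` least. -/
  isBetaSieveData : IsBetaSieveData κ (F, f, β, A)

namespace BetaSieveFunctions

variable {κ : ℝ}

/-- Bundle a quadruple satisfying `IsBetaSieveData` into `BetaSieveFunctions κ` (bridge). [folklore] -/
def ofIsBetaSieveData {B : (ℝ → ℝ) × (ℝ → ℝ) × ℝ × ℝ} (h : IsBetaSieveData κ B) :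
    BetaSieveFunctions κ where
  F := B.1
  f := B.2.1
  β := B.2.2.1
  A := B.2.2.2
  isBetaSieveData := h

/-- The underlying quadruple `(F, f, β, A)` of bundled `β`-sieve data (bridge, inverse to
`ofIsBetaSieveData`). [folklore] -/
def toProd (S : BetaSieveFunctions κ) : (ℝ → ℝ) × (ℝ → ℝ) × ℝ × ℝ :=
  (S.F, S.f, S.β, S.A)

/-- The underlying quadruple satisfies `IsBetaSieveData` (definition). [folklore] -/
theorem isBetaSieveData_toProd (S : BetaSieveFunctions κ) : IsBetaSieveData κ S.toProd :=
  S.isBetaSieveData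

/-- `BetaSieveFunctions κ` is equivalent to the subtype of quadruples satisfying `IsBetaSieveData κ`
(bridge between the bundled and unbundled forms). [folklore] -/
def equivSubtype (κ : ℝ) :
    BetaSieveFunctions κ ≃ {B : (ℝ → ℝ) × (ℝ → ℝ) × ℝ × ℝ // IsBetaSieveData κ B} where
  toFun S := ⟨S.toProd, S.isBetaSieveData⟩
  invFun B := ofIsBetaSieveData B.2
  left_inv S := by cases S; rfl
  right_inv B := by rcases B with ⟨⟨F, f, β, A⟩, h⟩; rfl

/-- The bundled data solve the system (projection of the hypothesis). [folklore] -/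
theorem isBetaSieveSolution (S : BetaSieveFunctions κ) : IsBetaSieveSolution κ S.F S.f S.β S.A :=
  S.isBetaSieveData.1

/-- `BetaSieveFunctions κ` is nonempty for `κ ≥ 1/2` (from the named fact `exists_isBetaSieveData`, hypothesis `hex`, D-0014). [folklore] -/
theorem nonempty (hex : exists_isBetaSieveData) (hκ : 1 / 2 ≤ κ) : Nonempty (BetaSieveFunctions κ) :=
  let ⟨_, h⟩ := hex hκ
  ⟨ofIsBetaSieveData h⟩

end BetaSieveFunctions

/-! ### The canonical `β`-sieve functions `F_κ, f_κ, β_κ` -/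

/-- `betaSieveData κ = (F_κ, f_κ, β_κ, A_κ)`, the `β`-sieve data of dimension `κ`, chosen by
`Classical.epsilon` over the (nonempty) product TYPE `(ℝ → ℝ) × (ℝ → ℝ) × ℝ × ℝ` — no proof enters the
definition. Its MEANING rests on the named-fact (D-0014) existence theorem `exists_isBetaSieveData` (for
`κ ≥ 1/2` the chosen quadruple satisfies `IsBetaSieveData κ`, `isBetaSieveData_betaSieveData`) and on
the uniqueness theorem `IsBetaSieveData.unique` of this file (any two such data agree on `(0, ∞)`).
(Friedlander–Iwaniec, *Opera de Cribro*, Ch. 11.) [folklore] -/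
def betaSieveData (κ : ℝ) : (ℝ → ℝ) × (ℝ → ℝ) × ℝ × ℝ :=
  Classical.epsilon (IsBetaSieveData κ)

/-- For `κ ≥ 1/2` the chosen data are `β`-sieve data (`Classical.epsilon_spec` and the named-fact (D-0014)
`exists_isBetaSieveData`). [folklore] -/
theorem isBetaSieveData_betaSieveData (hex : exists_isBetaSieveData) {κ : ℝ} (hκ : 1 / 2 ≤ κ) :
    IsBetaSieveData κ (betaSieveData κ) :=
  Classical.epsilon_spec (hex hκ)

/-- `upperSieveFun κ = F_κ`, the upper-bound function of the `β`-sieve of dimension `κ`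
(Friedlander–Iwaniec, *Opera de Cribro*, (11.41)–(11.44); Halberstam–Richert Ch. 8, (2.8)). Defined via
`Classical.epsilon` (`betaSieveData`): its meaning rests on the named-fact (D-0014) `exists_isBetaSieveData` and on
`IsBetaSieveData.unique`; only its values on `(0, ∞)` and only for `κ ≥ 1/2` are meaningful.
ERRATUM (2026-08-14): the least-`β` pin is not Iwaniec's definition (`β_κ − 1` = largest zero of
`g_κ`, Iwaniec 1980 §7): it agrees with it for `1/2 ≤ κ ≤ 1`
(`BetaSieveSmallDimension.upperSieveFun_eq_iwaniecUpperSieveFun`) but selects a different function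
for every `κ > 1` (`BetaSieveLargeDimension.upperSieveFun_ne_iwaniecUpperSieveFun`; `κ = 3/2`:
`SieveFunctionsProofs.siftingLimit_three_halves_lt`; `κ = 2`: `JurkatRichertRefutation.lean`);
Iwaniec's `F_κ` is `iwaniecUpperSieveFun κ` (Correction section).
[folklore] -/
def upperSieveFun (κ : ℝ) : ℝ → ℝ :=
  (betaSieveData κ).1

/-- `lowerSieveFun κ = f_κ`, the lower-bound function of the `β`-sieve of dimension `κ`
(Friedlander–Iwaniec, *Opera de Cribro*, (11.41)–(11.44); Halberstam–Richert Ch. 8, (2.8)). Defined via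
`Classical.epsilon` (`betaSieveData`): its meaning rests on the named-fact (D-0014) `exists_isBetaSieveData` and on
`IsBetaSieveData.unique`; only its values on `(0, ∞)` and only for `κ ≥ 1/2` are meaningful.
ERRATUM (2026-08-14): the least-`β` pin is not Iwaniec's definition (`β_κ − 1` = largest zero of
`g_κ`, Iwaniec 1980 §7): it agrees with it for `1/2 ≤ κ ≤ 1`
(`BetaSieveSmallDimension.lowerSieveFun_eq_iwaniecLowerSieveFun`) but selects a different function
for every `κ > 1` (`BetaSieveLargeDimension.lowerSieveFun_ne_iwaniecLowerSieveFun`; `κ = 3/2`: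
`SieveFunctionsProofs.siftingLimit_three_halves_lt`; `κ = 2`: `JurkatRichertRefutation.lean`);
Iwaniec's `f_κ` is `iwaniecLowerSieveFun κ` (Correction section).
[folklore] -/
def lowerSieveFun (κ : ℝ) : ℝ → ℝ :=
  (betaSieveData κ).2.1

/-- `siftingLimit κ = β_κ`, the sifting limit of the `β`-sieve of dimension `κ` (Friedlander–Iwaniec,
*Opera de Cribro*, §11.4, Table 11.1: `β_{1/2} = 1`, `β_1 = 2`). Defined via `Classical.epsilon`
(`betaSieveData`): its meaning rests on the named-fact (D-0014) `exists_isBetaSieveData` and on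
`IsBetaSieveData.unique`; only for `κ ≥ 1/2` is it meaningful. ERRATUM (2026-08-14): this least-`β`
pin is not Iwaniec's definition (`β_κ − 1` = largest zero of `g_κ`, Iwaniec 1980 §7):
`siftingLimit κ = iwaniecSiftingLimit κ` for `1/2 ≤ κ ≤ 1`
(`BetaSieveSmallDimension.siftingLimit_eq_iwaniecSiftingLimit`), but
`siftingLimit κ < iwaniecSiftingLimit κ` for every `κ > 1`
(`BetaSieveLargeDimension.siftingLimit_lt_iwaniecSiftingLimit`: `siftingLimit κ − 1` is the LEAST,
`β_κ − 1` the GREATEST positive zero of `g_κ`, and `g_κ` has at least two for `κ > 1`), e.g.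
`siftingLimit (3/2) = (5 − √3)/2 ≠ β_{3/2} = (5 + √3)/2` (`SieveFunctionsProofs.siftingLimit_three_halves`,
`iwaniecSiftingLimit_three_halves_eq`) and `1.39 < siftingLimit 2 < 1.393`
(`JurkatRichertRefutation.lean`; `β_2 − 1 ≈ 3.834` is the largest zero of `g_2`); Iwaniec's `β_κ` is
`iwaniecSiftingLimit κ` (Correction section). [folklore] -/
def siftingLimit (κ : ℝ) : ℝ :=
  (betaSieveData κ).2.2.1

/-- `betaSieveConst κ = A_κ`, the constant with `F_κ(s) = A_κ s^{−κ}` on `(0, β_κ + 1]`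
(Friedlander–Iwaniec (11.43); `A_1 = 2e^γ`). Defined via `Classical.epsilon` (`betaSieveData`): its
meaning rests on the named-fact (D-0014) `exists_isBetaSieveData` and on `IsBetaSieveData.unique`. [folklore] -/
def betaSieveConst (κ : ℝ) : ℝ :=
  (betaSieveData κ).2.2.2

/-- For `κ ≥ 1/2`, `(F_κ, f_κ, β_κ, A_κ)` solve the normalised `β`-sieve system. [folklore] -/
theorem isBetaSieveSolution_upperSieveFun_lowerSieveFun (hex : exists_isBetaSieveData) {κ : ℝ}
    (hκ : 1 / 2 ≤ κ) :
    IsBetaSieveSolution κ (upperSieveFun κ) (lowerSieveFun κ) (siftingLimit κ) (betaSieveConst κ) :=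
  (isBetaSieveData_betaSieveData hex hκ).1

/-- The canonical bundled `β`-sieve functions of dimension `κ ≥ 1/2`. [folklore] -/
def betaSieveFunctions (hex : exists_isBetaSieveData) {κ : ℝ} (hκ : 1 / 2 ≤ κ) : BetaSieveFunctions κ :=
  BetaSieveFunctions.ofIsBetaSieveData (isBetaSieveData_betaSieveData hex hκ)

/-- **Linear sieve: `β₁ = 2`** (Jurkat–Richert, Acta Arith. 11 (1965); Halberstam–Richert Thm 8.3;
Friedlander–Iwaniec, *Opera de Cribro*, §11.4 and Ch. 12). DISCHARGED: `siftingLimit_one_holds`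
(`LinearSieveExistence.lean`). [cite: HalberstamRichert1974, Thm 8.3–8.4] -/
def siftingLimit_one : Prop :=
  siftingLimit 1 = 2

/-- **Linear sieve, upper function**: `F₁(s) = 2e^γ / s` for `0 < s ≤ 3` (Jurkat–Richert 1965;
Halberstam–Richert Thm 8.3, (8.2.8); Friedlander–Iwaniec (12.1)–(12.2)). DISCHARGED:
`upperSieveFun_one_eq_holds` (`LinearSieveConstant.lean`, with `A_1 = 2e^γ` from `p_1(1) = e^{−γ}`).
[cite: JurkatRichertActaArith1965, Thm 4–5] -/
def upperSieveFun_one_eq : Prop :=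
  ∀ {s : ℝ} (_hs : s ∈ Set.Ioc (0 : ℝ) 3),
    upperSieveFun 1 s = 2 * Real.exp Real.eulerMascheroniConstant / s

/-- **Linear sieve, lower function**: `f₁(s) = 2e^γ log(s − 1) / s` for `2 ≤ s ≤ 4`
(Jurkat–Richert 1965; Halberstam–Richert Thm 8.3, (8.2.9); Friedlander–Iwaniec (12.1)–(12.2)).
DISCHARGED: `lowerSieveFun_one_eq_holds` (`LinearSieveConstant.lean`).
[cite: JurkatRichertActaArith1965, Thm 4–5] -/
def lowerSieveFun_one_eq : Prop :=
  ∀ {s : ℝ} (_hs : s ∈ Set.Icc (2 : ℝ) 4),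
    lowerSieveFun 1 s = 2 * Real.exp Real.eulerMascheroniConstant * Real.log (s - 1) / s

/-! ### Iwaniec's regular dimension condition `Ω(κ, L)` -/

/-- `HasIwaniecDimension g κ L`: the density `g` has dimension `κ` in Iwaniec's regular sense
`Ω(κ, L)` (Iwaniec, Acta Arith. 36 (1980), (1.2); Friedlander–Iwaniec, *Opera de Cribro*, (11.129);
Halberstam–Richert `Ω₂(κ, L)`): `0 ≤ g(p) < 1` for every prime `p`, and for all `2 ≤ w ≤ z`,
`∏_{w ≤ p < z} (1 − g(p))⁻¹ ≤ (log z / log w)^κ (1 + L / log w)`.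
This refines `HasSieveDimension g κ K` (`HasIwaniecDimension.hasSieveDimension`): the factor tends to
`1` as `w → ∞`, which is what the asymptotic sieve bounds with `F_κ, f_κ` require. [folklore] -/
def HasIwaniecDimension (g : ArithmeticFunction ℝ) (κ L : ℝ) : Prop :=
  (∀ p : ℕ, p.Prime → 0 ≤ g p ∧ g p < 1) ∧
    ∀ w z : ℝ, 2 ≤ w → w ≤ z →
      ∏ p ∈ (Nat.primesBelow ⌈z⌉₊).filter (fun p : ℕ => w ≤ (p : ℝ)), (1 - g p)⁻¹ ≤
        (Real.log z / Real.log w) ^ κ * (1 + L / Real.log w)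

namespace HasIwaniecDimension

variable {g : ArithmeticFunction ℝ} {κ L : ℝ}

/-- Under `Ω(κ, L)` one has `0 ≤ L` (take `w = z = 2`: the empty product is `1`). [folklore] -/
theorem nonneg (h : HasIwaniecDimension g κ L) : 0 ≤ L := by
  have h2 := h.2 2 2 le_rfl le_rfl
  have hlog : 0 < Real.log 2 := Real.log_pos one_lt_two
  have hempty : (Nat.primesBelow ⌈(2 : ℝ)⌉₊).filter (fun p : ℕ => (2 : ℝ) ≤ (p : ℝ)) = ∅ := by
    rw [Nat.ceil_ofNat, Nat.primesBelow_two, Finset.filter_empty]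
  rw [hempty, Finset.prod_empty, div_self hlog.ne', Real.one_rpow, one_mul] at h2
  have : 0 ≤ L / Real.log 2 := by linarith
  exact (div_nonneg_iff.mp this).elim (fun h => h.1) fun h => absurd h.2 (not_le.mpr hlog)

/-- `Ω(κ, L)` implies `Ω(κ)` with the constant `K = 1 + L / log 2` (since `log w ≥ log 2`). [folklore] -/
theorem hasSieveDimension (h : HasIwaniecDimension g κ L) :
    HasSieveDimension g κ (1 + L / Real.log 2) := by
  refine ⟨h.1, fun w z hw hwz => (h.2 w z hw hwz).trans ?_⟩
  have hlog2 : 0 < Real.log 2 := Real.log_pos one_lt_two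
  have hlogw : Real.log 2 ≤ Real.log w := Real.log_le_log two_pos hw
  have h1 : 0 ≤ Real.log z / Real.log w :=
    div_nonneg (Real.log_nonneg (by linarith)) (Real.log_nonneg (by linarith))
  rw [mul_comm]
  refine mul_le_mul_of_nonneg_right ?_ (Real.rpow_nonneg h1 _)
  have hdiv : L / Real.log w ≤ L / Real.log 2 := div_le_div_of_nonneg_left h.nonneg hlog2 hlogw
  linarith

end HasIwaniecDimension

/-! ### The least-`β` transcriptions of the sieve bounds: REFUTED and RETIRED (2026-08-15)

Until 2026-08-15 this section declared two named facts, D-0014 sorry-sweep transcriptions, in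
level-of-distribution form, of the `β`-sieve bounds (Jurkat–Richert, Acta Arith. 11 (1965), Thm 4–5
for `κ = 1`; Iwaniec, *Rosser's sieve*, Acta Arith. 36 (1980), Thm 1; Friedlander–Iwaniec, *Opera de
Cribro*, Thm 11.12–11.13; Halberstam–Richert Thm 8.3–8.4):

* `SieveSequence.jurkat_richert_upper`: for every sifted sequence `𝒜` whose density satisfies
  `Ω(κ, L)` (`HasIwaniecDimension`), `κ ≥ 1/2`, with level of distribution `x^θ`
  (`HasLevelOfDistribution`), `θ > 0`, and `X(x) ≥ 0` eventually: for every `ε > 0` and `δ > 0`, for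
  all large `x` and all `2 ≤ z ≤ x^{θ − δ}`,
  `S(𝒜, z; x) ≤ X(x) V(z) (upperSieveFun κ (θ log x / log z) + ε)`;
* `SieveSequence.jurkat_richert_lower`: under the same hypotheses,
  `X(x) V(z) (lowerSieveFun κ (θ log x / log z) − ε) ≤ S(𝒜, z; x)`.

Both are FALSE as stated: `upperSieveFun κ`, `lowerSieveFun κ` are the functions of the LEAST
admissible `β` (`IsBetaSieveData`), whereas Iwaniec's `F_κ, f_κ` belong to `β_κ = 1 +` the LARGEST
zero of `g_κ` (Iwaniec 1980, §7, p. 193; [Greaves2001, (4.2.4.10)]: "let `α` be the greatest zero of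
`q = r_{κ,κ}` … `β = α + 1` if `κ > 1/2`"). For `1/2 ≤ κ ≤ 1` the two pins coincide and the two
statements restricted to such `κ` are PROVED (`SieveSequence.jurkat_richert_upper_of_le_one`,
`SieveSequence.jurkat_richert_lower_of_le_one` in `BetaSieveSmallDimension.lean`; unconditionally
`…_of_le_one_holds` in `JurkatRichertHalfLt.lean`); for every `κ > 1` the least-`β` pin selects other
functions (`BetaSieveLargeDimension.upperSieveFun_ne_iwaniecUpperSieveFun`,
`lowerSieveFun_ne_iwaniecLowerSieveFun`), and for `κ = 2` (least `β ∈ (1.39, 1.393)`,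
`upperSieveFun 2 2 ≤ 0.4703`, `lowerSieveFun 2 2 ≥ 1.30`, against Iwaniec's `F_2(2) = A_2/4 ≈ 10.87`,
`f_2(2) = 0`) both statements are REFUTED by the pair-product sequence of dimension `2`:

* `SieveSequence.not_jurkat_richert_upper` (`JurkatRichertRefutation.lean`) proves the negation of
  the first displayed statement, stated there verbatim;
* `SieveSequence.not_jurkat_richert_lower` (ibid.) proves the negation of the second.

A refuted statement is not a published result, so the two `def`s were deleted from the named-fact
registry (defact verdict clean-up, 2026-08-15; human ruling: keep the `¬`-theorems, retire the
defs). The faithful statements — the same bounds with Iwaniec's `iwaniecUpperSieveFun κ`,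
`iwaniecLowerSieveFun κ` (greatest-`β` pin) — are `SieveSequence.Iwaniec1980_upper` /
`SieveSequence.Iwaniec1980_lower` in the Correction section below, derived there from the printed
Theorem 1 (`Iwaniec1980_thm1_upper/lower`, `SieveSequence.Iwaniec1980_upper_of_thm1`,
`…_lower_of_thm1`) and DISCHARGED as `SieveSequence.Iwaniec1980_upper_holds` /
`SieveSequence.Iwaniec1980_lower_holds` in `RosserSieveBetaOneBound.lean`. -/

-- literature-prover 2026-08-14 (provefact jurkat_richert_lower, verdict MISSTATED): uniqueness for the DDE system,
-- the greatest-β re-pin of Iwaniec's data, Theorem 1 in y-form, corrected corollaries + proved reductions (append-only below)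

/-! ### Uniqueness for the `β`-sieve initial value problem -/

namespace IsBetaSieveSolution

variable {κ : ℝ}

/-- One step of the method of steps for the homogeneous `β`-sieve system: if `φ` is continuous on
`(0, ∞)`, vanishes on `(0, a]` with `a ≥ 1`, and `(t^κ φ(t))' = κ t^{κ−1} ψ(t − 1)` for `t > a` where
`ψ` vanishes on `(0, a]`, then `φ` vanishes on `(0, a + 1]` (mean value theorem on `[a, s]`). [folklore] -/
theorem eqOn_zero_step {φ ψ : ℝ → ℝ} {a : ℝ} (ha : 1 ≤ a) (hcont : ContinuousOn φ (Set.Ioi 0))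
    (hφ : ∀ s ∈ Set.Ioc 0 a, φ s = 0) (hψ : ∀ s ∈ Set.Ioc 0 a, ψ s = 0)
    (hderiv : ∀ s : ℝ, a < s → HasDerivAt (fun t : ℝ => t ^ κ * φ t) (κ * s ^ (κ - 1) * ψ (s - 1)) s) :
    ∀ s ∈ Set.Ioc 0 (a + 1), φ s = 0 := by
  intro s hs
  by_cases hsa : s ≤ a
  · exact hφ s ⟨hs.1, hsa⟩
  have hsa : a < s := not_le.mp hsa
  have ha0 : 0 < a := by linarith
  -- `Φ t = t^κ φ t` is continuous on `[a, s]` and has derivative `0` on `(a, s)`.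
  have hΦcont : ContinuousOn (fun t : ℝ => t ^ κ * φ t) (Set.Icc a s) := by
    refine ContinuousOn.mul ?_ (hcont.mono fun t ht => lt_of_lt_of_le ha0 ht.1)
    exact fun t ht => (Real.continuousAt_rpow_const t κ (Or.inl (by linarith [ht.1]))).continuousWithinAt
  have hΦderiv : ∀ t ∈ Set.Ioo a s, HasDerivAt (fun t : ℝ => t ^ κ * φ t) ((fun _ : ℝ => (0 : ℝ)) t) t := by
    intro t ht
    have h1 := hderiv t ht.1
    have h2 : ψ (t - 1) = 0 := hψ (t - 1) ⟨by linarith [ht.1], by linarith [ht.2, hs.2]⟩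
    simpa [h2] using h1
  obtain ⟨c, _, hc⟩ := exists_hasDerivAt_eq_slope (fun t : ℝ => t ^ κ * φ t) (fun _ => (0 : ℝ)) hsa
    hΦcont hΦderiv
  have hslope : (s ^ κ * φ s - a ^ κ * φ a) / (s - a) = 0 := hc.symm
  rw [div_eq_zero_iff] at hslope
  rcases hslope with h | h
  · rw [hφ a ⟨ha0, le_rfl⟩, mul_zero, sub_zero] at h
    rcases mul_eq_zero.mp h with h' | h'
    · exact absurd h' (Real.rpow_pos_of_pos hs.1 κ).ne'
    · exact h'
  · exact absurd h (by linarith)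

/-- **Uniqueness for the `β`-sieve initial value problem.** Two solutions of the normalised
Rosser–Iwaniec system of the same dimension `κ` with the SAME parameter `β` have the same constant `A`
and agree on `(0, ∞)`: the difference `(F' − (A'/A) F, f' − (A'/A) f)` solves the homogeneous system with
zero initial data, hence vanishes on every `(0, β + n]` (method of steps, `eqOn_zero_step`), and the
normalisation `F, F' → 1` forces `A' = A`. [folklore] -/
theorem unique_of_beta_eq {F f F' f' : ℝ → ℝ} {β A A' : ℝ} (h : IsBetaSieveSolution κ F f β A)
    (h' : IsBetaSieveSolution κ F' f' β A') :
    A = A' ∧ Set.EqOn F F' (Set.Ioi 0) ∧ Set.EqOn f f' (Set.Ioi 0) := by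
  obtain ⟨c, hc⟩ : ∃ c : ℝ, c = A' / A := ⟨_, rfl⟩
  obtain ⟨U, hU⟩ : ∃ U : ℝ → ℝ, U = fun s => F' s - c * F s := ⟨_, rfl⟩
  obtain ⟨u, hu⟩ : ∃ u : ℝ → ℝ, u = fun s => f' s - c * f s := ⟨_, rfl⟩
  have hA : A ≠ 0 := h.pos.ne'
  -- initial data of the difference
  have hU0 : ∀ s ∈ Set.Ioc 0 (β + 1), U s = 0 := by
    intro s hs
    rw [hU]
    dsimp only
    rw [h.upper_eq s hs, h'.upper_eq s hs, hc]
    field_simp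
    ring
  have hu0 : ∀ s ∈ Set.Ioc 0 β, u s = 0 := by
    intro s hs
    rw [hu]
    dsimp only
    rw [h.lower_eq s hs, h'.lower_eq s hs, mul_zero, sub_zero]
  -- the difference solves the homogeneous system
  have hUderiv : ∀ s : ℝ, β + 1 < s →
      HasDerivAt (fun t : ℝ => t ^ κ * U t) (κ * s ^ (κ - 1) * u (s - 1)) s := by
    intro s hs
    have h1 := (h'.hasDerivAt_upper s hs).fun_sub ((h.hasDerivAt_upper s hs).const_mul c)
    have h2 : (fun t : ℝ => t ^ κ * U t) = fun t => t ^ κ * F' t - c * (t ^ κ * F t) := by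
      funext t; rw [hU]; ring
    have h3 : κ * s ^ (κ - 1) * f' (s - 1) - c * (κ * s ^ (κ - 1) * f (s - 1)) =
        κ * s ^ (κ - 1) * u (s - 1) := by
      rw [hu]; ring
    rw [h2, ← h3]
    exact h1
  have huderiv : ∀ s : ℝ, β < s →
      HasDerivAt (fun t : ℝ => t ^ κ * u t) (κ * s ^ (κ - 1) * U (s - 1)) s := by
    intro s hs
    have h1 := (h'.hasDerivAt_lower s hs).fun_sub ((h.hasDerivAt_lower s hs).const_mul c)
    have h2 : (fun t : ℝ => t ^ κ * u t) = fun t => t ^ κ * f' t - c * (t ^ κ * f t) := by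
      funext t; rw [hu]; ring
    have h3 : κ * s ^ (κ - 1) * F' (s - 1) - c * (κ * s ^ (κ - 1) * F (s - 1)) =
        κ * s ^ (κ - 1) * U (s - 1) := by
      rw [hU]; ring
    rw [h2, ← h3]
    exact h1
  have hUcont : ContinuousOn U (Set.Ioi 0) := by
    rw [hU]; exact h'.continuousOn_upper.sub (h.continuousOn_upper.const_smul c)
  have hucont : ContinuousOn u (Set.Ioi 0) := by
    rw [hu]; exact h'.continuousOn_lower.sub (h.continuousOn_lower.const_smul c)
  -- method of steps
  have hstep : ∀ n : ℕ, (∀ s ∈ Set.Ioc 0 (β + 1 + n), U s = 0) ∧ ∀ s ∈ Set.Ioc 0 (β + n), u s = 0 := by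
    intro n
    induction n with
    | zero => simp only [Nat.cast_zero, add_zero]; exact ⟨hU0, hu0⟩
    | succ n ih =>
      have hβn : 1 ≤ β + n := le_add_of_le_of_nonneg h.one_le (Nat.cast_nonneg n)
      -- first `u` on `(0, β + n + 1]`, then `U` on `(0, β + n + 2]`
      have hu' : ∀ s ∈ Set.Ioc 0 (β + n + 1), u s = 0 := by
        refine eqOn_zero_step (κ := κ) hβn hucont ih.2 (fun s hs => ih.1 s ⟨hs.1, ?_⟩) ?_
        · linarith [hs.2]
        · intro s hs
          exact huderiv s (by linarith [hs, (Nat.cast_nonneg n : (0 : ℝ) ≤ n)])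
      have hU' : ∀ s ∈ Set.Ioc 0 (β + 1 + n + 1), U s = 0 := by
        refine eqOn_zero_step (κ := κ) (by linarith) hUcont ih.1 (fun s hs => hu' s ⟨hs.1, ?_⟩) ?_
        · linarith [hs.2]
        · intro s hs
          exact hUderiv s (by linarith [hs, (Nat.cast_nonneg n : (0 : ℝ) ≤ n)])
      refine ⟨fun s hs => hU' s ⟨hs.1, ?_⟩, fun s hs => hu' s ⟨hs.1, ?_⟩⟩
      · push_cast at hs ⊢; linarith [hs.2]
      · push_cast at hs ⊢; linarith [hs.2]
  have hUzero : ∀ s : ℝ, 0 < s → U s = 0 := by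
    intro s hs
    obtain ⟨n, hn⟩ := exists_nat_ge s
    exact (hstep n).1 s ⟨hs, by linarith [h.one_le]⟩
  have huzero : ∀ s : ℝ, 0 < s → u s = 0 := by
    intro s hs
    obtain ⟨n, hn⟩ := exists_nat_ge s
    exact (hstep n).2 s ⟨hs, by linarith [h.one_le]⟩
  -- normalisation: `F' − c F → 1 − c` and `= 0` eventually, so `c = 1`
  have hc1 : c = 1 := by
    have h1 : Tendsto U atTop (nhds (1 - c * 1)) := by
      rw [hU]; exact (h'.tendsto_upper).sub (h.tendsto_upper.const_mul c)
    have h2 : Tendsto U atTop (nhds 0) := by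
      apply tendsto_const_nhds.congr'
      filter_upwards [eventually_gt_atTop 0] with s hs
      exact (hUzero s hs).symm
    have h3 := tendsto_nhds_unique h1 h2
    linarith
  refine ⟨?_, ?_, ?_⟩
  · have : A' / A = 1 := hc ▸ hc1
    field_simp at this
    linarith
  · intro s hs
    have := hUzero s hs
    rw [hU] at this
    dsimp only at this
    rw [hc1, one_mul, sub_eq_zero] at this
    exact this.symm
  · intro s hs
    have := huzero s hs
    rw [hu] at this
    dsimp only at this
    rw [hc1, one_mul, sub_eq_zero] at this
    exact this.symm

end IsBetaSieveSolution

/-- **Uniqueness of the `β`-sieve data** (`IsBetaSieveData.unique`) holds: the two parameters are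
equal by minimality, and then `IsBetaSieveSolution.unique_of_beta_eq` applies. [folklore] -/
theorem IsBetaSieveData.unique_holds : IsBetaSieveData.unique := by
  rintro κ ⟨F, f, β, A⟩ ⟨F', f', β', A'⟩ h h'
  have hβ : β = β' := le_antisymm (h.2 F' f' β' A' h'.1) (h'.2 F f β A h.1)
  subst hβ
  obtain ⟨hA, hF, hf⟩ := h.1.unique_of_beta_eq h'.1
  exact ⟨hF, hf, rfl, hA⟩

/-! ### Correction (2026-08-14): Iwaniec's `β_κ` is the GREATEST admissible parameter

`IsBetaSieveData κ` above pins `β` as the LEAST `β ≥ 1` for which the normalised system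
`IsBetaSieveSolution κ F f β A` is solvable, on the premise (module docstring, "Sifting limit") that
this least `β` is the sifting limit `β_κ` of Iwaniec's Theorem 1. The premise is not what the
sources print, and it fails for every `κ > 1` (`BetaSieveLargeDimension.siftingLimit_lt_iwaniecSiftingLimit`:
for `κ > 1` the adjoint `g_κ` has at least two positive zeros, the least-`β` pin sits at the least
and Iwaniec's `β_κ` at the greatest; explicitly for `κ = 3/2`,
`SieveFunctionsProofs.siftingLimit_three_halves_lt`, and for `κ = 2`, `JurkatRichertRefutation.lean`);
for `1/2 ≤ κ ≤ 1` the two pins coincide (`BetaSieveSmallDimension.lean`), so that for `κ ≥ 1/2`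
`siftingLimit κ = iwaniecSiftingLimit κ ↔ κ ≤ 1`
(`BetaSieveLargeDimension.siftingLimit_eq_iwaniecSiftingLimit_iff`).

* Iwaniec DEFINES `β − 1` as the LARGEST zero of the adjoint function `g = g_κ`,
  `(s g(s))' = κ g(s) + κ g(s + 1)` ((1.10); `g(s) ∼ s^{2κ−1}`, (5.6)) for `κ > 1/2`, and `β = 1`
  for `κ ≤ 1/2` (§6, p. 189, first sentence; §7, p. 193; likewise Tsang, §1: "`β_k − 1` = the
  largest positive zero of `g_k(s)`" [cite: Tsang1989, §1]); the positivity of his majorants `Q^±`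
  (Lemma 13) is obtained through Lemma 14, whose proof (p. 190: "since `β − 1` is the largest zero
  of `G'(s)`, `G(s)` is increasing for `s > β − 1`") uses this choice. The function `g_κ` has fewer
  than `2κ` zeros (§5.2, Corollary to Lemma 4), exactly one for `1/2 < κ < 1` (Lemma 5),
  `g_1(s) = s − 1`, `g_{1/2} = 1`; but for `κ = 3/2`, `g(s) = s² − 3s + 3/2` has the two zeros
  `(3 ∓ √3)/2` (§5.1, Example 2; §5.3: the largest is `(3 + √3)/2`), for `κ = 2`,
  `g(s) = s³ − 6s² + 9s − 8/3` (ibid., Example 2) has three positive zeros (three sign changes on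
  `[0, 4]`), and for large `κ` "the several largest zeros of `g_k(s)` are about `ck^{1/3}` apart"
  [cite: Tsang1989, Remark after Thm 1].
* If `IsBetaSieveSolution κ F f β A` holds, `m = F − f` satisfies `s m'(s) = −κ m(s) − κ m(s − 1)`
  for `s > β` (on `(β, β + 1]` because `f(s − 1) = 0` there), and Iwaniec's pairing (5.3) with the
  adjoint solution `g` is constant in `s ≥ β`:
  `s g(s) m(s) − κ ∫_{s−1}^{s} g(x + 1) m(x) dx = A (β − 1)^{1−κ} g(β − 1)` (evaluate at `s = β`,
  where `m(x) = A x^{−κ}` on `(0, β]`, using `κ x^{−κ} g(x + 1) = (x^{1−κ} g(x))'`; cf. the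
  computation leading to (7.12), p. 196, where the same pairing is evaluated for Iwaniec's
  solution). Letting `s → ∞` (`m = O(e^{−s})`, `g ≪ s^{2κ−1}`, p. 196) gives `g(β − 1) = 0`
  whenever `β > 1`. So every admissible `β > 1` lies in `1 + g_κ⁻¹(0)` and Iwaniec's `β_κ` is the
  GREATEST admissible parameter (given the existence of his solution); it is also the least one
  precisely when no smaller zero of `g_κ` (nor `β = 1`) is admissible. (This step is not printed
  as such; it is formalised in `SieveAdjoint.lean` — `IsBetaSieveSolution.adjoint_apply_eq_zero`,
  with `g_κ = SieveAdjoint.qFun κ` of `SieveFunctionsAdjoint.lean`: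
  `IsBetaSieveSolution.qFun_beta_sub_one_eq_zero` — and, for `β = 1`, in
  `BetaSieveSmallDimension.lean`: `IsBetaSieveSolution.one_lt_of_half_lt`.)
* (Converse — since PROVED, `BetaSieveForward.exists_isBetaSieveSolution_of_qFun_eq_zero` in
  `SieveFunctionsProofs.lean` — stated here with its heuristic background to explain why the
  least-`β` pin differs from `β_κ`.) The vanishing of this pairing is the only obstruction to superexponential
  decay of `m` (asymptotic theory of (5.1): the Laplace transform of `m` is an entire function
  plus a multiple, proportional to the pairing, of the branch `z^{2κ−1} exp(−κ Ein z)`), while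
  `F + f − 2` decays superexponentially for EVERY `β` once `A` is normalised as
  `A = 2(β − 1)^{κ−1}/h(β − 1)` (cf. (2.8), (7.13)); so the normalised system is solvable at every
  positive zero of `g_κ`. Numerically (method of steps with the trapezoidal rule, steps
  `1/700 … 1/4262`; a computation outside the tree, not formalised): for `κ = 3/2` and
  `β' = (5 − √3)/2 ≈ 1.634`, `F − f` decays like `e^{−s log s}` while `F + f → 0.6998·A > 0` (so
  `A = 2/0.6998 > 0`). Hence `siftingLimit (3/2) = (5 − √3)/2 ≈ 1.634 < β_{3/2} = (5 + √3)/2 ≈ 3.366`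
  (since PROVED: `SieveFunctionsProofs.siftingLimit_three_halves_lt`), with `lowerSieveFun (3/2)`
  positive just above `1.634` (`IsBetaSieveSolution.lower_pos`, `BetaSieveLargeDimension.lean`) and
  expected positive on all of `(1.634, ∞)`: not Iwaniec's `f_{3/2}`, so that
  the least-`β` sieve bounds (the former `SieveSequence.jurkat_richert_lower` / `jurkat_richert_upper`,
  refuted and retired) are NOT the cited Theorem 1 for such `κ` (a lower-bound sieve function
  positive below `β_κ` is asserted by no source).

The declarations below restate the theory with the faithful pin — the GREATEST `β`
(`IsGreatestBetaSieveData`) — under new names; the old declarations are left unchanged. Iwaniec's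
Theorem 1 itself is vendored in its printed `y`-form (`Iwaniec1980_thm1_lower`,
`Iwaniec1980_thm1_upper`), and the `Literature`-shaped level-of-distribution corollaries
`SieveSequence.Iwaniec1980_lower` / `SieveSequence.Iwaniec1980_upper` are DERIVED from it
(`SieveSequence.Iwaniec1980_lower_of_thm1`, `SieveSequence.Iwaniec1980_upper_of_thm1`), using the
uniqueness theorem `IsBetaSieveSolution.unique_of_beta_eq` (which also discharges
`IsBetaSieveData.unique` as `IsBetaSieveData.unique_holds`). -/

/-- `IsGreatestBetaSieveData κ (F, f, β, A)`: `(F, f, β, A)` solves the normalised Rosser–Iwaniec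
system of dimension `κ` (`IsBetaSieveSolution`) and `β` is the GREATEST parameter for which a
normalised solution exists (compare `IsBetaSieveData`: least). This pins Iwaniec's data: his
`β = β_κ` is `1 +` the largest zero of the adjoint function `g_κ` for `κ > 1/2` and `β = 1` for
`κ ≤ 1/2` (Iwaniec 1980, §7, p. 193), his `(F, f)` solve (1.8)–(1.9) with `B = 0` and `A > 0`
(p. 196) and satisfy `F, f = 1 + O(e^{−s})` (p. 173; (6.5), (7.7), §9), while every normalised
solution has `g_κ(β − 1) = 0` or `β = 1` (pairing identity (5.3), cf. (7.12); see the section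
docstring), so no normalised solution has a larger parameter. Stated on the product type so that
`Classical.epsilon` applies (`greatestBetaSieveData`).
[cite: IwaniecActaArith1980, §7 (p. 193) with (5.3), (7.12)] -/
def IsGreatestBetaSieveData (κ : ℝ) (B : (ℝ → ℝ) × (ℝ → ℝ) × ℝ × ℝ) : Prop :=
  IsBetaSieveSolution κ B.1 B.2.1 B.2.2.1 B.2.2.2 ∧
    ∀ (F' f' : ℝ → ℝ) (β' A' : ℝ), IsBetaSieveSolution κ F' f' β' A' → β' ≤ B.2.2.1

/-- Unfolding lemma for `IsGreatestBetaSieveData` on an explicit quadruple. [folklore] -/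
theorem isGreatestBetaSieveData_iff (κ : ℝ) (F f : ℝ → ℝ) (β A : ℝ) :
    IsGreatestBetaSieveData κ (F, f, β, A) ↔ IsBetaSieveSolution κ F f β A ∧
      ∀ (F' f' : ℝ → ℝ) (β' A' : ℝ), IsBetaSieveSolution κ F' f' β' A' → β' ≤ β :=
  Iff.rfl

namespace IsGreatestBetaSieveData

variable {κ : ℝ} {B B' : (ℝ → ℝ) × (ℝ → ℝ) × ℝ × ℝ}

/-- Greatest `β`-sieve data solve the normalised system (projection). [folklore] -/
theorem isBetaSieveSolution (h : IsGreatestBetaSieveData κ B) :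
    IsBetaSieveSolution κ B.1 B.2.1 B.2.2.1 B.2.2.2 :=
  h.1

/-- Two greatest `β`-sieve data of the same dimension have the same parameter `β` (each is `≤` the
other by maximality). [folklore] -/
theorem beta_eq (h : IsGreatestBetaSieveData κ B) (h' : IsGreatestBetaSieveData κ B') :
    B.2.2.1 = B'.2.2.1 :=
  le_antisymm (h'.2 _ _ _ _ h.1) (h.2 _ _ _ _ h'.1)

/-- **Uniqueness of the greatest `β`-sieve data**: two greatest `β`-sieve data of the same dimension
agree on `(0, ∞)` and have the same `β` and `A` (`beta_eq` and
`IsBetaSieveSolution.unique_of_beta_eq`). [folklore] -/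
theorem unique (h : IsGreatestBetaSieveData κ B) (h' : IsGreatestBetaSieveData κ B') :
    Set.EqOn B.1 B'.1 (Set.Ioi 0) ∧ Set.EqOn B.2.1 B'.2.1 (Set.Ioi 0) ∧
      B.2.2.1 = B'.2.2.1 ∧ B.2.2.2 = B'.2.2.2 := by
  obtain ⟨F, f, β, A⟩ := B
  obtain ⟨F', f', β', A'⟩ := B'
  have hβ : β = β' := h.beta_eq h'
  subst hβ
  obtain ⟨hA, hF, hf⟩ := h.1.unique_of_beta_eq h'.1
  exact ⟨hF, hf, rfl, hA⟩

end IsGreatestBetaSieveData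

/-- **Existence of Iwaniec's `β`-sieve functions** (Iwaniec, *Rosser's sieve*, Acta Arith. 36 (1980),
Thm 1 with §§5–7 and §9): for every dimension `κ ≥ 1/2` there is a normalised solution
`(F_κ, f_κ, β_κ, A_κ)` of the Rosser–Iwaniec system whose parameter `β_κ` is the greatest admissible
one — `β_κ − 1` is the largest zero of `g_κ`, `B = 0` and `A_κ = 2(β_κ − 1)^{κ−1}/h(β_κ − 1)` for
`κ > 1/2` ((2.8), p. 176 and p. 196), `β = 1`, `B = 0`, `A = 2(e^γ/π)^{1/2}` for `κ = 1/2` (p. 173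
and p. 196); `A > 0`, `F, f` continuous, `F, f = 1 + O(e^{−s})` (p. 173); maximality among ALL
normalised solutions by the pairing identity (5.3)/(7.12) (section docstring above; this last step
is not printed as such). (For `0 < κ < 1/2` Iwaniec's system has `B > 0` and is not of the shape
`IsBetaSieveSolution`.) DISCHARGED: `exists_isGreatestBetaSieveData_holds` (`SieveFunctionsProofs.lean`,
via Greaves's construction). [cite: IwaniecActaArith1980, Thm 1 and §7 (pp. 193–196)] -/
def exists_isGreatestBetaSieveData : Prop :=
  ∀ {κ : ℝ} (_hκ : 1 / 2 ≤ κ), ∃ B : (ℝ → ℝ) × (ℝ → ℝ) × ℝ × ℝ, IsGreatestBetaSieveData κ B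

/-! ### Iwaniec's canonical functions `F_κ, f_κ`, sifting limit `β_κ` and constant `A_κ` -/

/-- `greatestBetaSieveData κ = (F_κ, f_κ, β_κ, A_κ)`, Iwaniec's `β`-sieve data of dimension `κ`,
chosen by `Classical.epsilon` over `IsGreatestBetaSieveData κ` (greatest admissible `β`); no proof
enters the definition. Its MEANING rests on the named fact `exists_isGreatestBetaSieveData` (for
`κ ≥ 1/2` the chosen quadruple satisfies `IsGreatestBetaSieveData κ`,
`isGreatestBetaSieveData_greatestBetaSieveData`) and on the (proved) uniqueness theorem
`IsGreatestBetaSieveData.unique`. (Iwaniec 1980, (1.8)–(1.10) and §7.) [folklore] -/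
def greatestBetaSieveData (κ : ℝ) : (ℝ → ℝ) × (ℝ → ℝ) × ℝ × ℝ :=
  Classical.epsilon (IsGreatestBetaSieveData κ)

/-- For `κ ≥ 1/2` the chosen data are greatest `β`-sieve data (`Classical.epsilon_spec` and the
named fact `exists_isGreatestBetaSieveData`, hypothesis `hex`). [folklore] -/
theorem isGreatestBetaSieveData_greatestBetaSieveData (hex : exists_isGreatestBetaSieveData) {κ : ℝ}
    (hκ : 1 / 2 ≤ κ) : IsGreatestBetaSieveData κ (greatestBetaSieveData κ) :=
  Classical.epsilon_spec (hex hκ)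

/-- Any greatest `β`-sieve data of dimension `κ` make the chosen data greatest `β`-sieve data too
(`Classical.epsilon_spec` with the given witness; no appeal to `exists_isGreatestBetaSieveData`).
[folklore] -/
theorem IsGreatestBetaSieveData.greatestBetaSieveData {κ : ℝ} {B : (ℝ → ℝ) × (ℝ → ℝ) × ℝ × ℝ}
    (h : IsGreatestBetaSieveData κ B) : IsGreatestBetaSieveData κ (greatestBetaSieveData κ) :=
  Classical.epsilon_spec ⟨B, h⟩

/-- `iwaniecUpperSieveFun κ = F_κ`, the upper-bound function of Iwaniec's `β`-sieve of dimension `κ`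
(Iwaniec 1980, (1.4), (1.8)–(1.9); Friedlander–Iwaniec, *Opera de Cribro*, Ch. 11). Defined via
`Classical.epsilon` (`greatestBetaSieveData`); only its values on `(0, ∞)` and only for `κ ≥ 1/2` are
meaningful. [folklore] -/
def iwaniecUpperSieveFun (κ : ℝ) : ℝ → ℝ :=
  (greatestBetaSieveData κ).1

/-- `iwaniecLowerSieveFun κ = f_κ`, the lower-bound function of Iwaniec's `β`-sieve of dimension `κ`
(Iwaniec 1980, (1.5), (1.8)–(1.9); Friedlander–Iwaniec, *Opera de Cribro*, Ch. 11). Defined via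
`Classical.epsilon` (`greatestBetaSieveData`); only its values on `(0, ∞)` and only for `κ ≥ 1/2` are
meaningful. [folklore] -/
def iwaniecLowerSieveFun (κ : ℝ) : ℝ → ℝ :=
  (greatestBetaSieveData κ).2.1

/-- `iwaniecSiftingLimit κ = β_κ`, the sifting limit of Iwaniec's `β`-sieve of dimension `κ`:
`β_κ − 1` is the LARGEST zero of `g_κ` for `κ > 1/2`, `β_{1/2} = 1`, `β_1 = 2`,
`β_{3/2} = 1 + (3 + √3)/2` (Iwaniec 1980, §5.3 and §7). Defined via `Classical.epsilon`
(`greatestBetaSieveData`); only for `κ ≥ 1/2` is it meaningful. [folklore] -/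
def iwaniecSiftingLimit (κ : ℝ) : ℝ :=
  (greatestBetaSieveData κ).2.2.1

/-- `iwaniecSieveConst κ = A_κ`, the constant with `F_κ(s) = A_κ s^{−κ}` on `(0, β_κ + 1]`
(Iwaniec 1980, (1.8) and (2.8): `A = 2(β − 1)^{κ−1}/h(β − 1)`; `A_1 = 2e^γ`). Defined via
`Classical.epsilon` (`greatestBetaSieveData`). [folklore] -/
def iwaniecSieveConst (κ : ℝ) : ℝ :=
  (greatestBetaSieveData κ).2.2.2

/-- For `κ ≥ 1/2`, `(F_κ, f_κ, β_κ, A_κ)` solve the normalised `β`-sieve system (given the named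
fact `exists_isGreatestBetaSieveData`). [folklore] -/
theorem isBetaSieveSolution_iwaniecUpperSieveFun_iwaniecLowerSieveFun
    (hex : exists_isGreatestBetaSieveData) {κ : ℝ} (hκ : 1 / 2 ≤ κ) :
    IsBetaSieveSolution κ (iwaniecUpperSieveFun κ) (iwaniecLowerSieveFun κ) (iwaniecSiftingLimit κ)
      (iwaniecSieveConst κ) :=
  (isGreatestBetaSieveData_greatestBetaSieveData hex hκ).1

/-- Greatest `β`-sieve data agree with Iwaniec's canonical functions on `(0, ∞)`: if
`IsGreatestBetaSieveData κ B` then `B.1 = F_κ` and `B.2.1 = f_κ` on `(0, ∞)`, `B.2.2.1 = β_κ`,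
`B.2.2.2 = A_κ` (uniqueness). [folklore] -/
theorem IsGreatestBetaSieveData.eqOn_iwaniecSieveFun {κ : ℝ} {B : (ℝ → ℝ) × (ℝ → ℝ) × ℝ × ℝ}
    (h : IsGreatestBetaSieveData κ B) :
    Set.EqOn B.1 (iwaniecUpperSieveFun κ) (Set.Ioi 0) ∧
      Set.EqOn B.2.1 (iwaniecLowerSieveFun κ) (Set.Ioi 0) ∧
        B.2.2.1 = iwaniecSiftingLimit κ ∧ B.2.2.2 = iwaniecSieveConst κ :=
  h.unique h.greatestBetaSieveData

/-! ### Iwaniec's Theorem 1 (Rosser's sieve) in the printed `y`-form -/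

/-- **Rosser's sieve, lower bound** (Iwaniec, *Rosser's sieve*, Acta Arith. 36 (1980), Theorem 1,
(1.5) with (1.6)), in the vocabulary of `SieveSequence` (weights `a_n ≥ 0`, `n ≤ x`,
`A_d(x) = g(d) X(x) + R_d(x)`): for every `κ ≥ 1/2` there are greatest `β`-sieve data
`(F, f, β, A)` of dimension `κ` (Iwaniec's `F, f, β, A` of (1.8)–(1.10) and §7,
`IsGreatestBetaSieveData`) such that for every `L` there is a constant `C = C(κ, L)` with the
following property. For every sifted sequence whose density satisfies `Ω(κ, L)`
(`HasIwaniecDimension`), every `x` with `X(x) ≥ 0` and all `y ≥ z ≥ 2`, with `s = log y / log z`,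
`S(𝒜, z; x) ≥ X(x) V(z) (f(s) − C (log y)^{−1/3}) − ∑_{d < y, d ∣ P(z)} |R_d(x)|`.
Faithfulness notes: Iwaniec's error term is `e^{√K} Q(s) (log y)^{−1/3}` with
`Q(s) < exp(−s log s + s log log 3s + O_κ(s))` for `s ≥ 1` (1.6), which is bounded on `s ≥ 1`, whence
the constant `C(κ, L)`; his (1.3) (strict, `K ≥ 2`) follows from `Ω(κ, L)` with `K = L + 2`; his
`0 < ω(p)` (1.2) is arranged by declaring the primes with `g(p) = 0` non-sifting, which changes
`S(𝒜, z; x)` by at most `∑_{p < z, g(p) = 0} A_p(x) = ∑_{p < z, g(p) = 0} R_p(x)`, a sub-sum of the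
displayed remainder, and leaves `V(z)` and (1.3) unchanged; nonnegative real weights instead of a
finite integer sequence are covered by the same proof ((3.4)–(3.5) rest on a pointwise inequality),
cf. Friedlander–Iwaniec, *Opera de Cribro*, Thm 11.13. [cite: IwaniecActaArith1980, Thm 1 (1.5)–(1.6)] -/
def Iwaniec1980_thm1_lower : Prop :=
  ∀ {κ : ℝ} (_hκ : 1 / 2 ≤ κ), ∃ B : (ℝ → ℝ) × (ℝ → ℝ) × ℝ × ℝ, IsGreatestBetaSieveData κ B ∧
    ∀ L : ℝ, ∃ C : ℝ, ∀ (A : SieveSequence), HasIwaniecDimension A.density κ L →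
      ∀ x y z : ℝ, 2 ≤ z → z ≤ y → 0 ≤ A.size x →
        A.size x * A.densityProduct (primesProdBelow z) *
              (B.2.1 (Real.log y / Real.log z) - C * Real.log y ^ (-(1 / 3 : ℝ))) -
            ∑ d ∈ (Finset.range ⌈y⌉₊).filter (· ∣ primesProdBelow z), |A.remainder d x| ≤
          A.sifted x (primesProdBelow z)

/-- **Rosser's sieve, upper bound** (Iwaniec, *Rosser's sieve*, Acta Arith. 36 (1980), Theorem 1,
(1.4) with (1.6)), in the vocabulary of `SieveSequence`: for every `κ ≥ 1/2` there are greatest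
`β`-sieve data `(F, f, β, A)` of dimension `κ` (`IsGreatestBetaSieveData`) such that for every `L`
there is `C = C(κ, L)` with: for every sifted sequence whose density satisfies `Ω(κ, L)`, every `x`
with `X(x) ≥ 0` and all `y ≥ z ≥ 2`, `s = log y / log z`,
`S(𝒜, z; x) ≤ X(x) V(z) (F(s) + C (log y)^{−1/3}) + ∑_{d < y, d ∣ P(z)} |R_d(x)|`.
(Same faithfulness notes as `Iwaniec1980_thm1_lower`; for the upper bound, sifting additionally by the
primes with `g(p) = 0` only decreases `S`.) [cite: IwaniecActaArith1980, Thm 1 (1.4), (1.6)] -/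
def Iwaniec1980_thm1_upper : Prop :=
  ∀ {κ : ℝ} (_hκ : 1 / 2 ≤ κ), ∃ B : (ℝ → ℝ) × (ℝ → ℝ) × ℝ × ℝ, IsGreatestBetaSieveData κ B ∧
    ∀ L : ℝ, ∃ C : ℝ, ∀ (A : SieveSequence), HasIwaniecDimension A.density κ L →
      ∀ x y z : ℝ, 2 ≤ z → z ≤ y → 0 ≤ A.size x →
        A.sifted x (primesProdBelow z) ≤
          A.size x * A.densityProduct (primesProdBelow z) *
              (B.1 (Real.log y / Real.log z) + C * Real.log y ^ (-(1 / 3 : ℝ))) +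
            ∑ d ∈ (Finset.range ⌈y⌉₊).filter (· ∣ primesProdBelow z), |A.remainder d x|

/-- Both bounds of Iwaniec's Theorem 1 provide greatest `β`-sieve data, so each implies
`exists_isGreatestBetaSieveData`. [folklore] -/
theorem Iwaniec1980_thm1_lower.exists_isGreatestBetaSieveData (h : Iwaniec1980_thm1_lower) :
    exists_isGreatestBetaSieveData :=
  fun hκ => let ⟨B, hB, _⟩ := h hκ; ⟨B, hB⟩

/-! ### The corrected level-of-distribution corollaries -/

namespace SieveSequence

/-- **Lower bound of Iwaniec's `β`-sieve, level-of-distribution form** (corollary of Iwaniec,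
*Rosser's sieve*, Acta Arith. 36 (1980), Thm 1; for `κ = 1` Jurkat–Richert, Acta Arith. 11 (1965);
Friedlander–Iwaniec, *Opera de Cribro*, Thm 11.12–11.13). Let `𝒜` be a sifted sequence whose density
satisfies `Ω(κ, L)`, `κ ≥ 1/2`, with level of distribution `x^θ`, `θ > 0`, and `X(x) ≥ 0` eventually.
Then for every `ε > 0` and `δ > 0`, for all large `x` and all `2 ≤ z ≤ x^{θ − δ}`,
`S(𝒜, z; x) ≥ X(x) V(z) (f_κ(θ log x / log z) − ε)` with `f_κ = iwaniecLowerSieveFun κ` (Iwaniec's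
`f`, greatest-`β` pin). This is the retired `jurkat_richert_lower` with the corrected sieve function;
it is DERIVED from `Iwaniec1980_thm1_lower` in `Iwaniec1980_lower_of_thm1` (take `y = x^{θ − η}` with
`η ≤ δ/2` small, the level hypothesis with exponent `B = κ + 1`, `V(z) ≫ (log x)^{−κ}` from `Ω(κ, L)`,
and continuity of `f` plus `f → 1`). [cite: IwaniecActaArith1980, Thm 1 (corollary)] -/
def Iwaniec1980_lower : Prop :=
  ∀ (A : SieveSequence) {κ L θ : ℝ} (_hκ : 1 / 2 ≤ κ) (_hθ : 0 < θ)
    (_hdim : HasIwaniecDimension A.density κ L) (_hlevel : HasLevelOfDistribution A θ)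
    (_hsize : ∀ᶠ x : ℝ in atTop, 0 ≤ A.size x),
    ∀ ε δ : ℝ, 0 < ε → 0 < δ → ∀ᶠ x : ℝ in atTop, ∀ z : ℝ, 2 ≤ z → z ≤ x ^ (θ - δ) →
      A.size x * A.densityProduct (primesProdBelow z) *
          (iwaniecLowerSieveFun κ (θ * Real.log x / Real.log z) - ε) ≤
        A.sifted x (primesProdBelow z)

/-- **Upper bound of Iwaniec's `β`-sieve, level-of-distribution form** (corollary of Iwaniec,
*Rosser's sieve*, Acta Arith. 36 (1980), Thm 1; for `κ = 1` Jurkat–Richert 1965; Friedlander–Iwaniec,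
*Opera de Cribro*, Thm 11.12–11.13). Let `𝒜` be a sifted sequence whose density satisfies `Ω(κ, L)`,
`κ ≥ 1/2`, with level of distribution `x^θ`, `θ > 0`, and `X(x) ≥ 0` eventually. Then for every
`ε > 0` and `δ > 0`, for all large `x` and all `2 ≤ z ≤ x^{θ − δ}`,
`S(𝒜, z; x) ≤ X(x) V(z) (F_κ(θ log x / log z) + ε)` with `F_κ = iwaniecUpperSieveFun κ`. This is the
retired `jurkat_richert_upper` with the corrected sieve function; DERIVED from `Iwaniec1980_thm1_upper` in
`Iwaniec1980_upper_of_thm1`. [cite: IwaniecActaArith1980, Thm 1 (corollary)] -/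
def Iwaniec1980_upper : Prop :=
  ∀ (A : SieveSequence) {κ L θ : ℝ} (_hκ : 1 / 2 ≤ κ) (_hθ : 0 < θ)
    (_hdim : HasIwaniecDimension A.density κ L) (_hlevel : HasLevelOfDistribution A θ)
    (_hsize : ∀ᶠ x : ℝ in atTop, 0 ≤ A.size x),
    ∀ ε δ : ℝ, 0 < ε → 0 < δ → ∀ᶠ x : ℝ in atTop, ∀ z : ℝ, 2 ≤ z → z ≤ x ^ (θ - δ) →
      A.sifted x (primesProdBelow z) ≤
        A.size x * A.densityProduct (primesProdBelow z) *
          (iwaniecUpperSieveFun κ (θ * Real.log x / Real.log z) + ε)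

end SieveSequence

/-! ### Deriving the level-of-distribution corollaries from Theorem 1 -/

namespace HasIwaniecDimension

variable {A : SieveSequence} {κ L : ℝ}

/-- Under `Ω(κ, L)` the density product `V(z) = ∏_{p < z} (1 − g(p))` is positive (`g(p) < 1`).
[folklore] -/
theorem densityProduct_pos (h : HasIwaniecDimension A.density κ L) (z : ℝ) :
    0 < A.densityProduct (primesProdBelow z) := by
  unfold SieveSequence.densityProduct
  exact Finset.prod_pos fun p hp => sub_pos.mpr (h.1 p (Nat.prime_of_mem_primeFactors hp)).2

/-- Under `Ω(κ, L)`, `V(z)⁻¹ ≤ (log z / log 2)^κ (1 + L / log 2)` for `z ≥ 2` (the case `w = 2` of the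
dimension condition). [folklore] -/
theorem inv_densityProduct_le (h : HasIwaniecDimension A.density κ L) {z : ℝ} (hz : 2 ≤ z) :
    (A.densityProduct (primesProdBelow z))⁻¹ ≤
      (Real.log z / Real.log 2) ^ κ * (1 + L / Real.log 2) := by
  have h2 := h.2 2 z le_rfl hz
  rw [Finset.filter_true_of_mem fun p hp => by
    exact_mod_cast (Nat.prime_of_mem_primesBelow hp).two_le] at h2
  unfold SieveSequence.densityProduct
  rw [primeFactors_primesProdBelow, ← Finset.prod_inv_distrib]
  exact h2

/-- Under `Ω(κ, L)`, for `2 ≤ z` with `log z ≤ θ log x` (`θ, log x ≥ 0`):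
`V(z)⁻¹ ≤ (θ / log 2)^κ (1 + L / log 2) (log x)^κ`. [folklore] -/
theorem inv_densityProduct_le_of_log_le (h : HasIwaniecDimension A.density κ L) (hκ : 0 ≤ κ)
    {z θ x : ℝ} (hz : 2 ≤ z) (hθ : 0 ≤ θ) (hx : 0 ≤ Real.log x)
    (hzx : Real.log z ≤ θ * Real.log x) :
    (A.densityProduct (primesProdBelow z))⁻¹ ≤
      (θ / Real.log 2) ^ κ * (1 + L / Real.log 2) * Real.log x ^ κ := by
  have hlog2 : 0 < Real.log 2 := Real.log_pos one_lt_two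
  have hL : 0 ≤ 1 + L / Real.log 2 := by
    have := h.nonneg; positivity
  refine (h.inv_densityProduct_le hz).trans ?_
  have h1 : (Real.log z / Real.log 2) ^ κ ≤ (θ / Real.log 2 * Real.log x) ^ κ := by
    refine Real.rpow_le_rpow (div_nonneg (Real.log_nonneg (by linarith)) hlog2.le) ?_ hκ
    rw [div_mul_eq_mul_div]
    exact div_le_div_of_nonneg_right hzx hlog2.le
  calc (Real.log z / Real.log 2) ^ κ * (1 + L / Real.log 2)
      ≤ (θ / Real.log 2 * Real.log x) ^ κ * (1 + L / Real.log 2) :=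
        mul_le_mul_of_nonneg_right h1 hL
    _ = (θ / Real.log 2) ^ κ * (1 + L / Real.log 2) * Real.log x ^ κ := by
        rw [Real.mul_rpow (div_nonneg hθ hlog2.le) hx]; ring

end HasIwaniecDimension

/-- Common analytic core of `Iwaniec1980_lower_of_thm1` / `Iwaniec1980_upper_of_thm1`: if `φ` is
continuous on `(0, ∞)` with `φ → 1` at `+∞`, then for `ε, δ, θ > 0` there is `η ∈ (0, δ/2]`,
`η ≤ θ/2`, such that `|φ(θ ℓ) − φ((θ − η) ℓ)| ≤ ε/2` for every `ℓ > 0` with `(θ − η) ℓ > 1`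
(both arguments in the tail where `|φ − 1| < ε/4`, or both in the compact `[1, 2T]` at distance at
most the modulus of uniform continuity). Used with `ℓ = log x / log z`, `φ = f_κ` or `F_κ`. [folklore] -/
theorem exists_eta_of_tendsto_one {φ : ℝ → ℝ} (hcont : ContinuousOn φ (Set.Ioi 0))
    (hlim : Tendsto φ atTop (nhds 1)) {ε δ θ : ℝ} (hε : 0 < ε) (hδ : 0 < δ) (hθ : 0 < θ) :
    ∃ η : ℝ, 0 < η ∧ η ≤ δ / 2 ∧ η ≤ θ / 2 ∧
      ∀ ℓ : ℝ, 0 < ℓ → 1 < (θ - η) * ℓ → |φ (θ * ℓ) - φ ((θ - η) * ℓ)| ≤ ε / 2 := by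
  -- Step 1: tail
  obtain ⟨N, hN⟩ := Metric.tendsto_atTop.1 hlim (ε / 4) (by positivity)
  set T : ℝ := max N 1 with hT
  have hT1 : 1 ≤ T := le_max_right _ _
  have htail : ∀ t : ℝ, T ≤ t → |φ t - 1| < ε / 4 := fun t ht =>
    Real.dist_eq (φ t) 1 ▸ hN t ((le_max_left _ _).trans ht)
  -- Step 2: uniform continuity on `[1, 2T]`
  have hK : IsCompact (Set.Icc 1 (2 * T)) := isCompact_Icc
  have hcK : ContinuousOn φ (Set.Icc 1 (2 * T)) :=
    hcont.mono fun t ht => lt_of_lt_of_le one_pos ht.1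
  obtain ⟨ρ, hρ, hρc⟩ := Metric.uniformContinuousOn_iff_le.1 (hK.uniformContinuousOn_of_continuous hcK)
    (ε / 2) (by positivity)
  -- Step 3: choice of `η`
  refine ⟨min (δ / 2) (min (θ / 2) (ρ * θ / (2 * T))), ?_, min_le_left _ _,
    (min_le_right _ _).trans (min_le_left _ _), ?_⟩
  · have : 0 < ρ * θ / (2 * T) := by positivity
    positivity
  intro ℓ hℓ hs'
  set η := min (δ / 2) (min (θ / 2) (ρ * θ / (2 * T))) with hη
  have hηθ : η ≤ θ / 2 := (min_le_right _ _).trans (min_le_left _ _)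
  have hηρ : η ≤ ρ * θ / (2 * T) := (min_le_right _ _).trans (min_le_right _ _)
  have hη0 : 0 ≤ η := by
    have : 0 < ρ * θ / (2 * T) := by positivity
    positivity
  set s := θ * ℓ with hs
  set s' := (θ - η) * ℓ with hs'def
  have hss' : s' ≤ s := by rw [hs, hs'def]; nlinarith
  by_cases hTs' : T ≤ s'
  · -- both arguments in the tail
    have h1 := htail s' hTs'
    have h2 := htail s (hTs'.trans hss')
    rw [abs_lt] at h1 h2
    rw [abs_le]
    constructor <;> linarith [h1.1, h1.2, h2.1, h2.2]
  · -- both arguments in `[1, 2T]`, at distance `≤ ρ`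
    have hTs' : s' < T := not_le.mp hTs'
    have hs2 : s ≤ 2 * s' := by rw [hs, hs'def]; nlinarith
    have hmem : s ∈ Set.Icc 1 (2 * T) := ⟨by linarith, by linarith⟩
    have hmem' : s' ∈ Set.Icc 1 (2 * T) := ⟨hs'.le, by linarith⟩
    have hdist : dist s s' ≤ ρ := by
      rw [Real.dist_eq, abs_of_nonneg (by linarith)]
      have hT0 : 0 < T := by linarith
      -- `s − s' = η ℓ ≤ η s'/(θ − η) ≤ (2η/θ) T ≤ ρ`
      have h1 : s - s' = η * ℓ := by rw [hs, hs'def]; ring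
      have h2 : η * ℓ * (θ - η) = η * s' := by rw [hs'def]; ring
      have h3 : θ / 2 ≤ θ - η := by linarith
      have h4 : η * ℓ * (θ / 2) ≤ η * ℓ * (θ - η) :=
        mul_le_mul_of_nonneg_left h3 (by positivity)
      have h5 : η * s' ≤ η * T := mul_le_mul_of_nonneg_left hTs'.le hη0
      have h6 : η * T ≤ ρ * θ / 2 := by
        rw [le_div_iff₀ (by positivity)] at hηρ
        nlinarith
      rw [h1]
      nlinarith
    have := hρc s hmem s' hmem' hdist
    rwa [Real.dist_eq] at this

namespace SieveSequence

/-- The remainder sum of Theorem 1 is dominated by the level-of-distribution sum: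
`∑_{d < y, d ∣ P(z)} |R_d(x)| ≤ ∑_{d ≤ y, d squarefree} |R_d(x)|`. [folklore] -/
theorem sum_remainder_dvd_le (A : SieveSequence) (x y z : ℝ) :
    ∑ d ∈ (Finset.range ⌈y⌉₊).filter (· ∣ primesProdBelow z), |A.remainder d x| ≤
      ∑ d ∈ (Icc 1 ⌊y⌋₊).filter Squarefree, |A.remainder d x| := by
  refine Finset.sum_le_sum_of_subset_of_nonneg (fun d hd => ?_) fun _ _ _ => abs_nonneg _
  rw [Finset.mem_filter, Finset.mem_range] at hd
  rw [Finset.mem_filter, Finset.mem_Icc]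
  have hd0 : d ≠ 0 := fun h0 => primesProdBelow_ne_zero z (zero_dvd_iff.mp (h0 ▸ hd.2))
  refine ⟨⟨Nat.one_le_iff_ne_zero.mpr hd0, Nat.le_floor (le_of_lt (Nat.lt_ceil.mp hd.1))⟩,
    (squarefree_primesProdBelow z).squarefree_of_dvd hd.2⟩

/-- **`Iwaniec1980_thm1_lower` implies `Iwaniec1980_lower`**: the level-of-distribution corollary
of the lower bound in Iwaniec's Theorem 1 (choose `y = x^{θ − η}` with `η` from
`exists_eta_of_tendsto_one`, bound the remainder by the level hypothesis with exponent `κ + 1`, use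
`V(z)⁻¹ ≪ (log x)^κ` from `Ω(κ, L)`, and transfer from Iwaniec's `f` to `iwaniecLowerSieveFun κ` by
uniqueness). [folklore] -/
theorem Iwaniec1980_lower_of_thm1 (h : Iwaniec1980_thm1_lower) : Iwaniec1980_lower := by
  intro A κ L θ hκ hθ hdim hlevel hsize ε δ hε hδ
  obtain ⟨B, hB, hC⟩ := h hκ
  obtain ⟨C, hC⟩ := hC L
  obtain ⟨F, f, β, a⟩ := B
  have hsol : IsBetaSieveSolution κ F f β a := hB.1
  have hfeq : Set.EqOn f (iwaniecLowerSieveFun κ) (Set.Ioi 0) := hB.eqOn_iwaniecSieveFun.2.1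
  -- analytic input on `f`
  obtain ⟨η, hη0, hηδ, hηθ, hcontf⟩ :=
    exists_eta_of_tendsto_one hsol.continuousOn_lower hsol.tendsto_lower hε hδ hθ
  have hθ' : 0 < θ - η := by linarith
  -- level of distribution at exponent `θ − η`, saving `(log x)^{κ+1}`
  obtain ⟨C₁, hC₁⟩ := Asymptotics.isBigO_iff.1 (hlevel η hη0 (κ + 1) (by linarith))
  -- constants
  have hlog2 : 0 < Real.log 2 := Real.log_pos one_lt_two
  set K₀ : ℝ := (θ / Real.log 2) ^ κ * (1 + L / Real.log 2) with hK₀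
  have hK₀ : 0 < K₀ := by
    have := hdim.nonneg
    positivity
  -- eventual smallness of the two error terms
  have hev1 : ∀ᶠ x : ℝ in atTop, max C 0 * ((θ - η) * Real.log x) ^ (-(1 / 3 : ℝ)) ≤ ε / 4 := by
    have ht : Tendsto (fun x : ℝ => max C 0 * ((θ - η) * Real.log x) ^ (-(1 / 3 : ℝ))) atTop
        (nhds (max C 0 * 0)) :=
      ((tendsto_rpow_neg_atTop (by norm_num : (0 : ℝ) < 1 / 3)).comp
        (Real.tendsto_log_atTop.const_mul_atTop hθ')).const_mul _
    rw [mul_zero] at ht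
    exact ht.eventually_le_const (by positivity)
  have hev2 : ∀ᶠ x : ℝ in atTop, max C₁ 0 * K₀ ≤ ε / 4 * Real.log x :=
    (Real.tendsto_log_atTop.const_mul_atTop (by positivity)).eventually_ge_atTop _
  filter_upwards [hsize, hC₁, hev1, hev2, eventually_ge_atTop (2 : ℝ)] with x hX hR h1 h2 hx2
  intro z hz hzx
  -- notation and positivity
  have hx0 : 0 < x := by linarith
  have hx1 : 1 ≤ x := by linarith
  have hlx : 0 < Real.log x := Real.log_pos (by linarith)
  have hlz : 0 < Real.log z := Real.log_pos (by linarith)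
  have hz0 : 0 < z := by linarith
  set y : ℝ := x ^ (θ - η) with hy
  have hlogy : Real.log y = (θ - η) * Real.log x := Real.log_rpow hx0 _
  have hzy : z ≤ y := hzx.trans (Real.rpow_le_rpow_of_exponent_le hx1 (by linarith))
  have hlzx : Real.log z ≤ (θ - δ) * Real.log x := by
    have := Real.log_le_log hz0 hzx
    rwa [Real.log_rpow hx0] at this
  have hθδ : 0 < θ - δ := by
    by_contra hcon
    have : (θ - δ) * Real.log x ≤ 0 := mul_nonpos_of_nonpos_of_nonneg (not_lt.mp hcon) hlx.le
    linarith
  set ℓ : ℝ := Real.log x / Real.log z with hℓ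
  have hℓ0 : 0 < ℓ := div_pos hlx hlz
  have hs' : 1 < (θ - η) * ℓ := by
    -- `log z ≤ (θ − δ) log x < (θ − η) log x`
    rw [hℓ, ← mul_div_assoc, one_lt_div hlz]
    calc Real.log z ≤ (θ - δ) * Real.log x := hlzx
      _ < (θ - η) * Real.log x := by nlinarith
  have hsarg : Real.log y / Real.log z = (θ - η) * ℓ := by rw [hlogy, hℓ, mul_div_assoc]
  have htarg : θ * Real.log x / Real.log z = θ * ℓ := by rw [hℓ, mul_div_assoc]
  -- the main terms
  set X := A.size x with hXdef
  set V := A.densityProduct (primesProdBelow z) with hVdef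
  have hV : 0 < V := hdim.densityProduct_pos z
  have hXV : 0 ≤ X * V := mul_nonneg hX hV.le
  -- Theorem 1
  have hmain := hC A hdim x y z hz hzy hX
  rw [hsarg] at hmain
  -- error term 1: `C (log y)^{-1/3} ≤ ε/4`
  have herr1 : -(ε / 4) ≤ -(C * Real.log y ^ (-(1 / 3 : ℝ))) := by
    rw [hlogy, neg_le_neg_iff]
    refine le_trans ?_ h1
    exact mul_le_mul_of_nonneg_right (le_max_left _ _) (Real.rpow_nonneg (by positivity) _)
  -- error term 2: the remainder is `≤ (ε/4) X V`
  have hVinv : V⁻¹ ≤ K₀ * Real.log x ^ κ :=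
    hdim.inv_densityProduct_le_of_log_le (by linarith) hz hθ.le hlx.le
      (hlzx.trans (by nlinarith))
  have hrem : ∑ d ∈ (Finset.range ⌈y⌉₊).filter (· ∣ primesProdBelow z), |A.remainder d x| ≤
      ε / 4 * (X * V) := by
    refine (A.sum_remainder_dvd_le x y z).trans ?_
    have hR' : ∑ d ∈ (Icc 1 ⌊y⌋₊).filter Squarefree, |A.remainder d x| ≤
        max C₁ 0 * (X / Real.log x ^ (κ + 1)) := by
      have hn1 : ‖∑ d ∈ (Icc 1 ⌊x ^ (θ - η)⌋₊).filter Squarefree, |A.remainder d x|‖ =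
          ∑ d ∈ (Icc 1 ⌊y⌋₊).filter Squarefree, |A.remainder d x| :=
        Real.norm_of_nonneg (Finset.sum_nonneg fun _ _ => abs_nonneg _)
      have hn2 : ‖A.size x / Real.log x ^ (κ + 1)‖ = X / Real.log x ^ (κ + 1) :=
        Real.norm_of_nonneg (div_nonneg hX (Real.rpow_nonneg hlx.le _))
      rw [← hn1, ← hn2]
      exact hR.trans (mul_le_mul_of_nonneg_right (le_max_left _ _) (norm_nonneg _))
    refine hR'.trans ?_
    -- `max C₁ 0 · X/(log x)^{κ+1} ≤ (ε/4) X V` from `V⁻¹ ≤ K₀ (log x)^κ` and `max C₁ 0 · K₀ ≤ (ε/4) log x`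
    have hlk : 0 < Real.log x ^ κ := Real.rpow_pos_of_pos hlx κ
    have hV' : 1 ≤ V * (K₀ * Real.log x ^ κ) := by
      have := mul_le_mul_of_nonneg_left hVinv hV.le
      rwa [mul_inv_cancel₀ hV.ne'] at this
    rw [Real.rpow_add hlx, Real.rpow_one, ← mul_div_assoc, div_le_iff₀ (by positivity)]
    calc max C₁ 0 * X = max C₁ 0 * X * 1 := by ring
      _ ≤ max C₁ 0 * X * (V * (K₀ * Real.log x ^ κ)) :=
          mul_le_mul_of_nonneg_left hV' (by positivity)
      _ = (max C₁ 0 * K₀) * (X * V * Real.log x ^ κ) := by ring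
      _ ≤ (ε / 4 * Real.log x) * (X * V * Real.log x ^ κ) :=
          mul_le_mul_of_nonneg_right h2 (by positivity)
      _ = ε / 4 * (X * V) * (Real.log x ^ κ * Real.log x) := by ring
  -- continuity: `f((θ-η)ℓ) ≥ f(θ ℓ) − ε/2`, and `f(θ ℓ) = f_κ(θ ℓ)`
  have hcont := hcontf ℓ hℓ0 hs'
  rw [abs_le] at hcont
  have hfκ : f (θ * ℓ) = iwaniecLowerSieveFun κ (θ * ℓ) := hfeq (show (0 : ℝ) < θ * ℓ by positivity)
  rw [htarg, ← hfκ]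
  -- assemble
  have hstep : X * V * (f (θ * ℓ) - ε) ≤
      X * V * (f ((θ - η) * ℓ) - C * Real.log y ^ (-(1 / 3 : ℝ))) - ε / 4 * (X * V) := by
    nlinarith [hcont.1, hcont.2, herr1, hXV]
  linarith [hmain, hrem, hstep]

/-- **`Iwaniec1980_thm1_upper` implies `Iwaniec1980_upper`** (same derivation as
`Iwaniec1980_lower_of_thm1`, with Iwaniec's `F` and `iwaniecUpperSieveFun κ`). [folklore] -/
theorem Iwaniec1980_upper_of_thm1 (h : Iwaniec1980_thm1_upper) : Iwaniec1980_upper := by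
  intro A κ L θ hκ hθ hdim hlevel hsize ε δ hε hδ
  obtain ⟨B, hB, hC⟩ := h hκ
  obtain ⟨C, hC⟩ := hC L
  obtain ⟨F, f, β, a⟩ := B
  have hsol : IsBetaSieveSolution κ F f β a := hB.1
  have hFeq : Set.EqOn F (iwaniecUpperSieveFun κ) (Set.Ioi 0) := hB.eqOn_iwaniecSieveFun.1
  obtain ⟨η, hη0, hηδ, hηθ, hcontF⟩ :=
    exists_eta_of_tendsto_one hsol.continuousOn_upper hsol.tendsto_upper hε hδ hθ
  have hθ' : 0 < θ - η := by linarith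
  obtain ⟨C₁, hC₁⟩ := Asymptotics.isBigO_iff.1 (hlevel η hη0 (κ + 1) (by linarith))
  have hlog2 : 0 < Real.log 2 := Real.log_pos one_lt_two
  set K₀ : ℝ := (θ / Real.log 2) ^ κ * (1 + L / Real.log 2) with hK₀
  have hK₀ : 0 < K₀ := by
    have := hdim.nonneg
    positivity
  have hev1 : ∀ᶠ x : ℝ in atTop, max C 0 * ((θ - η) * Real.log x) ^ (-(1 / 3 : ℝ)) ≤ ε / 4 := by
    have ht : Tendsto (fun x : ℝ => max C 0 * ((θ - η) * Real.log x) ^ (-(1 / 3 : ℝ))) atTop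
        (nhds (max C 0 * 0)) :=
      ((tendsto_rpow_neg_atTop (by norm_num : (0 : ℝ) < 1 / 3)).comp
        (Real.tendsto_log_atTop.const_mul_atTop hθ')).const_mul _
    rw [mul_zero] at ht
    exact ht.eventually_le_const (by positivity)
  have hev2 : ∀ᶠ x : ℝ in atTop, max C₁ 0 * K₀ ≤ ε / 4 * Real.log x :=
    (Real.tendsto_log_atTop.const_mul_atTop (by positivity)).eventually_ge_atTop _
  filter_upwards [hsize, hC₁, hev1, hev2, eventually_ge_atTop (2 : ℝ)] with x hX hR h1 h2 hx2
  intro z hz hzx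
  have hx0 : 0 < x := by linarith
  have hx1 : 1 ≤ x := by linarith
  have hlx : 0 < Real.log x := Real.log_pos (by linarith)
  have hlz : 0 < Real.log z := Real.log_pos (by linarith)
  have hz0 : 0 < z := by linarith
  set y : ℝ := x ^ (θ - η) with hy
  have hlogy : Real.log y = (θ - η) * Real.log x := Real.log_rpow hx0 _
  have hzy : z ≤ y := hzx.trans (Real.rpow_le_rpow_of_exponent_le hx1 (by linarith))
  have hlzx : Real.log z ≤ (θ - δ) * Real.log x := by
    have := Real.log_le_log hz0 hzx
    rwa [Real.log_rpow hx0] at this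
  have hθδ : 0 < θ - δ := by
    by_contra hcon
    have : (θ - δ) * Real.log x ≤ 0 := mul_nonpos_of_nonpos_of_nonneg (not_lt.mp hcon) hlx.le
    linarith
  set ℓ : ℝ := Real.log x / Real.log z with hℓ
  have hℓ0 : 0 < ℓ := div_pos hlx hlz
  have hs' : 1 < (θ - η) * ℓ := by
    rw [hℓ, ← mul_div_assoc, one_lt_div hlz]
    calc Real.log z ≤ (θ - δ) * Real.log x := hlzx
      _ < (θ - η) * Real.log x := by nlinarith
  have hsarg : Real.log y / Real.log z = (θ - η) * ℓ := by rw [hlogy, hℓ, mul_div_assoc]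
  have htarg : θ * Real.log x / Real.log z = θ * ℓ := by rw [hℓ, mul_div_assoc]
  set X := A.size x with hXdef
  set V := A.densityProduct (primesProdBelow z) with hVdef
  have hV : 0 < V := hdim.densityProduct_pos z
  have hXV : 0 ≤ X * V := mul_nonneg hX hV.le
  have hmain := hC A hdim x y z hz hzy hX
  rw [hsarg] at hmain
  have herr1 : C * Real.log y ^ (-(1 / 3 : ℝ)) ≤ ε / 4 := by
    rw [hlogy]
    refine le_trans ?_ h1
    exact mul_le_mul_of_nonneg_right (le_max_left _ _) (Real.rpow_nonneg (by positivity) _)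
  have hVinv : V⁻¹ ≤ K₀ * Real.log x ^ κ :=
    hdim.inv_densityProduct_le_of_log_le (by linarith) hz hθ.le hlx.le
      (hlzx.trans (by nlinarith))
  have hrem : ∑ d ∈ (Finset.range ⌈y⌉₊).filter (· ∣ primesProdBelow z), |A.remainder d x| ≤
      ε / 4 * (X * V) := by
    refine (A.sum_remainder_dvd_le x y z).trans ?_
    have hR' : ∑ d ∈ (Icc 1 ⌊y⌋₊).filter Squarefree, |A.remainder d x| ≤
        max C₁ 0 * (X / Real.log x ^ (κ + 1)) := by
      have hn1 : ‖∑ d ∈ (Icc 1 ⌊x ^ (θ - η)⌋₊).filter Squarefree, |A.remainder d x|‖ =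
          ∑ d ∈ (Icc 1 ⌊y⌋₊).filter Squarefree, |A.remainder d x| :=
        Real.norm_of_nonneg (Finset.sum_nonneg fun _ _ => abs_nonneg _)
      have hn2 : ‖A.size x / Real.log x ^ (κ + 1)‖ = X / Real.log x ^ (κ + 1) :=
        Real.norm_of_nonneg (div_nonneg hX (Real.rpow_nonneg hlx.le _))
      rw [← hn1, ← hn2]
      exact hR.trans (mul_le_mul_of_nonneg_right (le_max_left _ _) (norm_nonneg _))
    refine hR'.trans ?_
    have hlk : 0 < Real.log x ^ κ := Real.rpow_pos_of_pos hlx κ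
    have hV' : 1 ≤ V * (K₀ * Real.log x ^ κ) := by
      have := mul_le_mul_of_nonneg_left hVinv hV.le
      rwa [mul_inv_cancel₀ hV.ne'] at this
    rw [Real.rpow_add hlx, Real.rpow_one, ← mul_div_assoc, div_le_iff₀ (by positivity)]
    calc max C₁ 0 * X = max C₁ 0 * X * 1 := by ring
      _ ≤ max C₁ 0 * X * (V * (K₀ * Real.log x ^ κ)) :=
          mul_le_mul_of_nonneg_left hV' (by positivity)
      _ = (max C₁ 0 * K₀) * (X * V * Real.log x ^ κ) := by ring
      _ ≤ (ε / 4 * Real.log x) * (X * V * Real.log x ^ κ) :=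
          mul_le_mul_of_nonneg_right h2 (by positivity)
      _ = ε / 4 * (X * V) * (Real.log x ^ κ * Real.log x) := by ring
  have hcont := hcontF ℓ hℓ0 hs'
  rw [abs_le] at hcont
  have hFκ : F (θ * ℓ) = iwaniecUpperSieveFun κ (θ * ℓ) := hFeq (show (0 : ℝ) < θ * ℓ by positivity)
  rw [htarg, ← hFκ]
  have hstep : X * V * (F ((θ - η) * ℓ) + C * Real.log y ^ (-(1 / 3 : ℝ))) + ε / 4 * (X * V) ≤
      X * V * (F (θ * ℓ) + ε) := by
    nlinarith [hcont.1, hcont.2, herr1, hXV]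
  linarith [hmain, hrem, hstep]

end SieveSequence

end Literature.NumberTheory.Sieve
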